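import Literature.Barriers.CriticalPhenomena.GridSAWFormulaDrawing
import Literature.Barriers.CriticalPhenomena.GridSAWGridFormulaGraphExplicit
import HarnessLib

/-!
# The grid drawing of the graph of a formula, VII: the drawing draws `graphOf ψ`

Continuation of `GridSAWFormulaDrawing.lean` (the embedding `E₀` of Liśkiewicz–Ogihara–Toda 2003,
proof of Theorem 7; split only for size). This file identifies what is drawn with the abstract
construction of `GridFormulaGadgets.lean`/`GridFormulaCount.lean`: the abstract edges of the kinds
(`absEdges`, decided against the wired edges), the recipe of a tile (`BSpec.absGad/absCell/absConns`,
decided against the bundles) and its reading as the placed gadgets, cells, slots and connectors of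
`graphOf ψ` (`chord_gadget`, `cell_slots`, `cell_type`, `conn_edge_drawn`), whence
**`adj_iff_draws`** (adjacency in `graphOf ψ` is the existence of a drawn edge with the two names as
ends, via the explicit edge list of `GridSAWGridFormulaGraphExplicit.lean`) and
**`dverts_toFinset`** (the drawn vertices are `vertsOf ψ`), with the two ends `0 = conn 0` and
`lastQ` drawn (`zero_mem_dverts`, `lastQ_mem_dverts`).

## References

* M. Liśkiewicz, M. Ogihara, S. Toda, TCS 304 (2003) 129–156, §3 (Lemma 4) and §4 (proof of
  Theorem 7, `E₀`).
-/

namespace Literature.Barriers.CriticalPhenomena.GridSAW.FormulaDrawing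

open Literature.Computability.Complexity (CNF)
open Literature.Combinatorics.SimpleGraph Literature.Combinatorics.SimpleGraph.GridFormula
open Literature.Combinatorics.SimpleGraph.GridCell (conn vtx)

variable {ψ : CNF ℕ}

/-! ## The abstract edges of the kinds

Every kind draws a definite piece of the abstract graph `graphOf ψ`
(`Literature/Combinatorics/SimpleGraph/GridFormula*.lean`): a cell (its edges that are not slots of
gadgets, and the edge from its connector to its entry corner), a connector edge (exit corner to the
next connector), or a placed rail gadget (rails, rung halves, port edges). We spell these pieces out
as reference pairs, from the abstract side's own tables (`CellTy.edgeList`, `CellTy.pIdx/qIdx`, the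
rail templates `RailXOR.Γ`, `RailOR1.Γ`, `RailOR3.Γ`), and check by `decide` that the generated edge
tables of the kinds have exactly these end pairs. -/

section absEdges

open RailGadget RailV

/-- All vertices of a rail template, listed. [folklore] -/
def allRV (k K m : ℕ) : List (RailV k K m) :=
  ((List.finRange k).flatMap fun r => (List.finRange K).map fun t => node (r, t)) ++
    (List.finRange m).map mid ++ ((List.finRange k).flatMap fun r => [port r true, port r false])

/-- The list is complete. [folklore] -/
theorem mem_allRV {k K m : ℕ} (v : RailV k K m) : v ∈ allRV k K m := by
  rcases v with ⟨r, t⟩ | ρ | ⟨r, _ | _⟩ <;> simp [allRV]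

/-- **The directed edges of a rail template** (its Boolean relation, listed). [folklore] -/
def templatePairs {k K m : ℕ} (Γ : RailGadget k K m) : List (RailV k K m × RailV k K m) :=
  ((allRV k K m).flatMap fun x => (allRV k K m).map fun y => (x, y)).filter fun p => Γ.relB p.1 p.2

/-- Membership in the directed edges. [folklore] -/
theorem mem_templatePairs {k K m : ℕ} {Γ : RailGadget k K m} {p : RailV k K m × RailV k K m} :
    p ∈ templatePairs Γ ↔ Γ.relB p.1 p.2 = true := by
  obtain ⟨x, y⟩ := p
  simp [templatePairs, mem_allRV]

/-- The three gadget templates in use. [folklore] -/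
inductive GadShape
  | xor | or1 | or3
  deriving DecidableEq, Repr

namespace GadShape

/-- Rails. [folklore] -/
def k : GadShape → ℕ | xor => 2 | or1 => 1 | or3 => 3
/-- Nodes per rail. [folklore] -/
def K : GadShape → ℕ | xor => 4 | or1 => 2 | or3 => 6
/-- Rungs. [folklore] -/
def m : GadShape → ℕ | xor => 4 | or1 => 1 | or3 => 9
/-- The template (`HamiltonianRailGadgets.lean`). [folklore] -/
def Γ : (sh : GadShape) → RailGadget sh.k sh.K sh.m
  | xor => RailXOR.Γ
  | or1 => RailOR1.Γ
  | or3 => RailOR3.Γ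

end GadShape

/-- **The data of a chord kind**: family code, template shape, and for each rail the cell of its
slot (tile offset, position) and the slot's two local vertices (first end at the rail's node `0`).
[folklore] -/
structure ChordData where
  /-- family code -/
  f : ℕ
  /-- template shape -/
  sh : GadShape
  /-- slot cells and slot ends of the rails -/
  rails : List ((ℤ × ℤ) × ℕ × (ℕ × ℕ))
  deriving DecidableEq

/-- The reference of a template vertex of a chord. [folklore] -/
def ChordData.toRef (cd : ChordData) : RailV cd.sh.k cd.sh.K cd.sh.m → Ref
  | node x => .gad 0 0 cd.f (x.1.val * cd.sh.K + x.2.val)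
  | mid ρ => .gad 0 0 cd.f (cd.sh.k * cd.sh.K + ρ.val)
  | port r top =>
    let rl := cd.rails.getD r.val ((0, 0), 0, (0, 0))
    .cell rl.1.1 rl.1.2 rl.2.1 ((if top then rl.2.2.1 else rl.2.2.2) + 1)

/-- **The chord kinds and their data** (slots as in `tileGad` / `gad` / `clauseGad` of
`GridFormulaGadgets.lean`). [folklore] -/
def chordData : Kind → Option ChordData
  | .growB => some ⟨0, .xor, [((0, -1), 2, (3, 7)), ((0, 0), 0, (9, 10))]⟩
  | .growC => some ⟨0, .xor, [((0, -1), 2, (3, 7)), ((0, 0), 0, (0, 4))]⟩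
  | .gin1 => some ⟨1, .xor, [((0, 0), 0, (3, 7)), ((0, 0), 1, (9, 10))]⟩
  | .gin2 => some ⟨2, .xor, [((0, 0), 1, (3, 7)), ((0, 0), 2, (9, 10))]⟩
  | .gcC => some ⟨1, .xor, [((0, 0), 0, (2, 3)), ((0, 0), 1, (8, 12))]⟩
  | .grC => some ⟨2, .xor, [((0, 0), 0, (0, 1)), ((0, 0), 1, (2, 1))]⟩
  | .gkC => some ⟨3, .xor, [((0, 0), 1, (15, 14)), ((0, 0), 2, (0, 4))]⟩
  | .gcpC => some ⟨4, .xor, [((0, 0), 0, (3, 7)), ((0, 0), 2, (13, 14))]⟩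
  | .gcolC => some ⟨5, .xor, [((-1, 0), 1, (11, 15)), ((0, 0), 0, (13, 14))]⟩
  | .gcolT => some ⟨5, .xor, [((-1, 0), 1, (1, 2)), ((0, 0), 0, (13, 14))]⟩
  | .glandC0 => some ⟨6, .xor, [((-1, 0), 1, (11, 15)), ((0, 0), 0, (0, 4))]⟩
  | .glandC3 => some ⟨6, .xor, [((-1, 0), 1, (11, 15)), ((0, 0), 0, (9, 10))]⟩
  | .glandT0 => some ⟨6, .xor, [((-1, 0), 1, (1, 2)), ((0, 0), 0, (0, 4))]⟩
  | .glandT3 => some ⟨6, .xor, [((-1, 0), 1, (1, 2)), ((0, 0), 0, (9, 10))]⟩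
  | .gor1 => some ⟨7, .or1, [((0, 0), 0, (0, 1))]⟩
  | .gor3 => some ⟨7, .or3, [((0, 0), 0, (0, 1)), ((0, 1), 0, (0, 1)), ((0, 2), 0, (0, 1))]⟩
  | _ => none

/-- **The cell kinds and their data**: cell type, position in the tile, used (slotted) edges as
unordered vertex pairs `(min, max)`. [folklore] -/
def cellData : Kind → Option (GridCell.CellTy × ℕ × List (Fin 16 × Fin 16))
  | .cbead0_s0_1s0_4 => some (.bead, 0, [(0, 1), (0, 4)])
  | .cbead0_s0_1s9_10 => some (.bead, 0, [(0, 1), (9, 10)])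
  | .cbead0_s3_7s9_10 => some (.bead, 0, [(3, 7), (9, 10)])
  | .cbead0_s3_7 => some (.bead, 0, [(3, 7)])
  | .cbead1_s1_2s3_7s9_10 => some (.bead, 1, [(1, 2), (3, 7), (9, 10)])
  | .cbead1_s3_7s9_10 => some (.bead, 1, [(3, 7), (9, 10)])
  | .cbead2_s3_7s9_10 => some (.bead, 2, [(3, 7), (9, 10)])
  | .cbead2_s9_10 => some (.bead, 2, [(9, 10)])
  | .cbead2 => some (.bead, 2, [])
  | .cpc0_s0_1s0_4s2_3s3_7s13_14 => some (.pc, 0, [(0, 1), (0, 4), (2, 3), (3, 7), (13, 14)])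
  | .cpc0_s0_1s2_3s3_7s13_14 => some (.pc, 0, [(0, 1), (2, 3), (3, 7), (13, 14)])
  | .cpc2_s0_4s13_14 => some (.pc, 2, [(0, 4), (13, 14)])
  | .cpc2_s0_4s3_7s13_14 => some (.pc, 2, [(0, 4), (3, 7), (13, 14)])
  | .cpct1_s1_2s8_12s11_15s14_15 => some (.pct, 1, [(1, 2), (8, 12), (11, 15), (14, 15)])
  | _ => none

/-- **The connector kinds and their data**: position and type of the exited cell, column offset and
position of the entered cell. [folklore] -/
def connData : Kind → Option (ℕ × GridCell.CellTy × ℤ × ℕ)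
  | .qin37bead => some (0, .bead, 0, 1)
  | .qin37pc => some (0, .pc, 0, 1)
  | .qin72bead => some (1, .bead, 0, 2)
  | .qin72pct => some (1, .pct, 0, 2)
  | .qx107bead => some (2, .bead, 1, 0)
  | .qx107pc => some (2, .pc, 1, 0)
  | .qx37bead => some (0, .bead, 1, 0)
  | _ => none

/-- **The abstract edges a kind draws**, as reference pairs. [folklore] -/
def absEdges (κ : Kind) : List (Ref × Ref) :=
  match chordData κ, cellData κ, connData κ with
  | some cd, _, _ => (templatePairs cd.sh.Γ).map fun p => (cd.toRef p.1, cd.toRef p.2)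
  | none, some (ty, c, U), _ =>
    ((ty.edgeList.filter fun e => !decide (e ∈ U)).map fun e => (Ref.cell 0 0 c (e.1.val + 1), Ref.cell 0 0 c (e.2.val + 1))) ++
      [(.cell 0 0 c 0, .cell 0 0 c (ty.pIdx.val + 1))]
  | none, none, some (c, ty, dj, c') => [(.cell 0 0 c (ty.qIdx.val + 1), .cell 0 dj c' 0)]
  | none, none, none => []

/-- Two lists of pairs have the same underlying set of unordered pairs. [folklore] -/
def edgeSetEqB (l₁ l₂ : List (Ref × Ref)) : Bool :=
  (l₁.all fun p => l₂.contains p || l₂.contains p.swap) && (l₂.all fun p => l₁.contains p || l₁.contains p.swap)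

/-- Every kind is a chord, a cell or a connector. [folklore] -/
theorem kind_classified (κ : Kind) : (chordData κ).isSome || (cellData κ).isSome || (connData κ).isSome := by
  cases κ <;> decide

/-- **The generated edge tables draw exactly the abstract edges.** [folklore] -/
theorem absEdges_ok (κ : Kind) : edgeSetEqB ((Kind.wedges κ).map fun e => (e.1, e.2.1)) (absEdges κ) = true := by
  cases κ <;> decide +kernel

/-- Two lists have the same underlying set. [folklore] -/
def listSetEqB (l₁ l₂ : List Ref) : Bool := (l₁.all fun r => l₂.contains r) && (l₂.all fun r => l₁.contains r)

/-- **The abstract vertices a kind owns**: a cell kind the connector and the listed vertices of its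
cell, a chord kind the inner vertices of its template, a connector none. [folklore] -/
def absVerts (κ : Kind) : List Ref :=
  match chordData κ, cellData κ with
  | some cd, _ => (List.range (cd.sh.k * cd.sh.K + cd.sh.m)).map fun idx => Ref.gad 0 0 cd.f idx
  | none, some (ty, c, _) => Ref.cell 0 0 c 0 :: ty.vertList.map fun v => Ref.cell 0 0 c (v.val + 1)
  | none, none => []

/-- **The generated vertex tables own exactly the abstract vertices.** [folklore] -/
theorem absVerts_ok (κ : Kind) : listSetEqB ((Kind.verts κ).map Prod.fst) (absVerts κ) = true := by
  cases κ <;> decide +kernel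

end absEdges

/-! ### Edges, vertices and slots of placed gadgets -/

section placement

open RailGadget RailV

/-- **Adjacency in a placed gadget**: the images of a directed template edge, in either order.
[folklore] -/
theorem GX_adj_iff (P : RailPlacement) {a b : ℕ} :
    P.GX.Adj a b ↔ ∃ p ∈ templatePairs P.Γ, (a = P.embFun p.1 ∧ b = P.embFun p.2) ∨ (a = P.embFun p.2 ∧ b = P.embFun p.1) := by
  rw [RailPlacement.GX, SimpleGraph.map_adj]
  simp only [RailPlacement.emb_apply]
  constructor
  · rintro ⟨x, y, hxy, rfl, rfl⟩
    rcases (P.Γ.adj_iff.1 hxy).2 with h | h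
    · exact ⟨(x, y), mem_templatePairs.2 h, Or.inl ⟨rfl, rfl⟩⟩
    · exact ⟨(y, x), mem_templatePairs.2 h, Or.inr ⟨rfl, rfl⟩⟩
  · rintro ⟨⟨x, y⟩, hp, h⟩
    have hrel := mem_templatePairs.1 hp
    have hne : x ≠ y := fun he => by subst he; rw [GridFormulaFP.relB_irrefl] at hrel; exact Bool.false_ne_true hrel
    rcases h with ⟨rfl, rfl⟩ | ⟨rfl, rfl⟩
    · exact ⟨x, y, P.Γ.adj_iff.2 ⟨hne, Or.inl hrel⟩, rfl, rfl⟩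
    · exact ⟨y, x, P.Γ.adj_iff.2 ⟨hne.symm, Or.inr hrel⟩, rfl, rfl⟩

/-- **The vertices of a placed gadget** are the numbers of its block. [folklore] -/
theorem mem_VX_iff (P : RailPlacement) {v : ℕ} : v ∈ P.VX ↔ P.base ≤ v ∧ v < P.base + (P.k * P.K + P.m) := by
  refine ⟨P.mem_VX_bounds, fun ⟨h1, h2⟩ => ?_⟩
  have hK := P.Γ.pos
  rw [RailPlacement.VX, Finset.mem_map]
  simp only [RailGadget.mem_VX_iff, RailPlacement.emb_apply]
  by_cases hn : v - P.base < P.k * P.K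
  · refine ⟨node (⟨(v - P.base) / P.K, (Nat.div_lt_iff_lt_mul hK).2 hn⟩, ⟨(v - P.base) % P.K, Nat.mod_lt _ hK⟩), rfl, ?_⟩
    simp only [RailPlacement.embFun]
    have := Nat.div_add_mod (v - P.base) P.K
    rw [Nat.mul_comm] at this
    omega
  · refine ⟨mid ⟨v - P.base - P.k * P.K, by omega⟩, rfl, ?_⟩
    simp only [RailPlacement.embFun]
    omega

/-- The numbering of an XOR-chord's template with block base `base` and slot ends `s₀, s₁`.
[folklore] -/
def xorEmb (base : ℕ) (s₀ s₁ : ℕ × ℕ) : RailV 2 4 4 → ℕ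
  | node x => base + (x.1.val * 4 + x.2.val)
  | mid ρ => base + (2 * 4 + ρ.val)
  | port r true => (if r.val = 0 then s₀ else s₁).1
  | port r false => (if r.val = 0 then s₀ else s₁).2

/-- The XOR-chord placement of `xorAt?`, named (same literal as in `GridFormulaGadgets.lean`).
[folklore] -/
def xorP (g k₁ : ℕ) (e₁ : Fin 16 × Fin 16) (k₂ : ℕ) (e₂ : Fin 16 × Fin 16)
    (h : k₁ < ncells ψ ∧ k₂ < ncells ψ ∧ k₁ ≠ k₂ ∧ e₁.1 ≠ e₁.2 ∧ e₂.1 ≠ e₂.2) : RailPlacement where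
  k := 2
  K := 4
  m := 4
  Γ := RailXOR.Γ
  base := gbase ψ g
  ends r := if r = 0 then gs k₁ e₁ else gs k₂ e₂
  ends_lt r := by
    split_ifs <;> exact ⟨vtx_lt_gbase ψ (by tauto) _ _, vtx_lt_gbase ψ (by tauto) _ _⟩
  ends_ne r := by
    split_ifs
    · exact fun he => h.2.2.2.1 (GridCell.vtx_injective _ he)
    · exact fun he => h.2.2.2.2 (GridCell.vtx_injective _ he)
  ends_distinct r r' hrr := by
    have hcases : ∀ s : Fin 2, s = 0 ∨ s = 1 := by decide
    have hk := h.2.2.1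
    rcases hcases r with rfl | rfl <;> rcases hcases r' with rfl | rfl
    · exact absurd rfl hrr
    · simp only [↓reduceIte, Fin.one_eq_zero_iff, OfNat.ofNat_ne_one, gs, ne_eq, GridCell.vtx_inj]; tauto
    · simp only [Fin.one_eq_zero_iff, OfNat.ofNat_ne_one, ↓reduceIte, gs, ne_eq, GridCell.vtx_inj]; tauto
    · exact absurd rfl hrr

/-- `xorAt?` is the named placement. [folklore] -/
theorem xorAt?_eq_xorP {g k₁ k₂ : ℕ} {e₁ e₂ : Fin 16 × Fin 16}
    (h : k₁ < ncells ψ ∧ k₂ < ncells ψ ∧ k₁ ≠ k₂ ∧ e₁.1 ≠ e₁.2 ∧ e₂.1 ≠ e₂.2) :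
    xorAt? ψ g k₁ e₁ k₂ e₂ = some (xorP g k₁ e₁ k₂ e₂ h) := by
  unfold xorAt?; rw [dif_pos h]; rfl

/-- The numbering of the named XOR placement. [folklore] -/
theorem embFun_xorP {g k₁ k₂ : ℕ} {e₁ e₂ : Fin 16 × Fin 16}
    (h : k₁ < ncells ψ ∧ k₂ < ncells ψ ∧ k₁ ≠ k₂ ∧ e₁.1 ≠ e₁.2 ∧ e₂.1 ≠ e₂.2) (w : RailV 2 4 4) :
    (xorP g k₁ e₁ k₂ e₂ h).embFun w = xorEmb (gbase ψ g) (gs k₁ e₁) (gs k₂ e₂) w := by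
  rcases w with ⟨r, t⟩ | ρ | ⟨r, _ | _⟩
  · rfl
  · rfl
  · show ((if r = 0 then gs k₁ e₁ else gs k₂ e₂)).2 = _
    simp only [xorEmb, Fin.ext_iff, Fin.val_zero]
  · show ((if r = 0 then gs k₁ e₁ else gs k₂ e₂)).1 = _
    simp only [xorEmb, Fin.ext_iff, Fin.val_zero]

/-- **The XOR-chord placement, described**: block, slots, edges. [folklore] -/
theorem xorP_spec {g k₁ k₂ : ℕ} {e₁ e₂ : Fin 16 × Fin 16}
    (h : k₁ < ncells ψ ∧ k₂ < ncells ψ ∧ k₁ ≠ k₂ ∧ e₁.1 ≠ e₁.2 ∧ e₂.1 ≠ e₂.2) :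
    (xorP g k₁ e₁ k₂ e₂ h).VX = (Finset.range 12).image (gbase ψ g + ·) ∧
    (xorP g k₁ e₁ k₂ e₂ h).S = {gs k₁ e₁, gs k₂ e₂} ∧
    ∀ a b, (xorP g k₁ e₁ k₂ e₂ h).GX.Adj a b ↔ ∃ p ∈ templatePairs RailXOR.Γ,
      (a = xorEmb (gbase ψ g) (gs k₁ e₁) (gs k₂ e₂) p.1 ∧ b = xorEmb (gbase ψ g) (gs k₁ e₁) (gs k₂ e₂) p.2) ∨
      (a = xorEmb (gbase ψ g) (gs k₁ e₁) (gs k₂ e₂) p.2 ∧ b = xorEmb (gbase ψ g) (gs k₁ e₁) (gs k₂ e₂) p.1) := by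
  refine ⟨?_, ?_, fun a b => ?_⟩
  · ext v
    rw [mem_VX_iff, Finset.mem_image]
    simp only [Finset.mem_range]
    show gbase ψ g ≤ v ∧ v < gbase ψ g + (2 * 4 + 4) ↔ _
    constructor
    · rintro ⟨h1, h2⟩; exact ⟨v - gbase ψ g, by omega, by omega⟩
    · rintro ⟨i, hi, rfl⟩; omega
  · ext e
    rw [RailPlacement.mem_S_iff]
    simp only [Finset.mem_insert, Finset.mem_singleton]
    show (∃ r : Fin 2, e = if r = 0 then gs k₁ e₁ else gs k₂ e₂) ↔ _
    constructor
    · rintro ⟨r, rfl⟩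
      by_cases hr : r = 0
      · simp [hr]
      · simp [hr]
    · rintro (rfl | rfl)
      · exact ⟨0, by simp⟩
      · exact ⟨1, by simp⟩
  · rw [GX_adj_iff]
    simp only [embFun_xorP]
    rfl

end placement

section placementOr

open RailGadget RailV

/-- The numbering of the one-input OR-gadget's template. [folklore] -/
def or1Emb (base : ℕ) (s₀ : ℕ × ℕ) : RailV 1 2 1 → ℕ
  | node x => base + (x.1.val * 2 + x.2.val)
  | mid ρ => base + (1 * 2 + ρ.val)
  | port _ true => s₀.1
  | port _ false => s₀.2

/-- The one-input OR placement of `or1At?`, named. [folklore] -/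
def or1P (g k : ℕ) (h : k < ncells ψ) : RailPlacement where
  k := 1
  K := 2
  m := 1
  Γ := RailOR1.Γ
  base := gbase ψ g
  ends _ := gs k Slot.bS0
  ends_lt _ := ⟨vtx_lt_gbase ψ h _ _, vtx_lt_gbase ψ h _ _⟩
  ends_ne _ he := absurd (GridCell.vtx_injective _ he) (by decide)
  ends_distinct r r' hrr := absurd (Subsingleton.elim r r') hrr

/-- `or1At?` is the named placement. [folklore] -/
theorem or1At?_eq_or1P {g k : ℕ} (h : k < ncells ψ) : or1At? ψ g k = some (or1P g k h) := by
  unfold or1At?; rw [dif_pos h]; rfl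

/-- **The one-input OR placement, described.** [folklore] -/
theorem or1P_spec {g k : ℕ} (h : k < ncells ψ) :
    (or1P (ψ := ψ) g k h).VX = (Finset.range 3).image (gbase ψ g + ·) ∧
    (or1P (ψ := ψ) g k h).S = {gs k Slot.bS0} ∧
    ∀ a b, (or1P (ψ := ψ) g k h).GX.Adj a b ↔ ∃ p ∈ templatePairs RailOR1.Γ,
      (a = or1Emb (gbase ψ g) (gs k Slot.bS0) p.1 ∧ b = or1Emb (gbase ψ g) (gs k Slot.bS0) p.2) ∨
      (a = or1Emb (gbase ψ g) (gs k Slot.bS0) p.2 ∧ b = or1Emb (gbase ψ g) (gs k Slot.bS0) p.1) := by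
  have hemb : ∀ w, (or1P (ψ := ψ) g k h).embFun w = or1Emb (gbase ψ g) (gs k Slot.bS0) w := by
    intro w; rcases w with ⟨r, t⟩ | ρ | ⟨r, _ | _⟩ <;> rfl
  refine ⟨?_, ?_, fun a b => ?_⟩
  · ext v
    rw [mem_VX_iff, Finset.mem_image]
    simp only [Finset.mem_range]
    show gbase ψ g ≤ v ∧ v < gbase ψ g + (1 * 2 + 1) ↔ _
    constructor
    · rintro ⟨h1, h2⟩; exact ⟨v - gbase ψ g, by omega, by omega⟩
    · rintro ⟨i, hi, rfl⟩; omega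
  · ext e
    rw [RailPlacement.mem_S_iff]
    simp only [Finset.mem_singleton]
    show (∃ _ : Fin 1, e = gs k Slot.bS0) ↔ _
    exact ⟨fun ⟨_, he⟩ => he, fun he => ⟨0, he⟩⟩
  · rw [GX_adj_iff]
    simp only [hemb]
    rfl

/-- The numbering of the three-input OR-gadget's template. [folklore] -/
def or3Emb (base k : ℕ) : RailV 3 6 9 → ℕ
  | node x => base + (x.1.val * 6 + x.2.val)
  | mid ρ => base + (3 * 6 + ρ.val)
  | port r true => (gs (k + r.val) Slot.bS0).1
  | port r false => (gs (k + r.val) Slot.bS0).2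

/-- The three-input OR placement of `or3At?`, named. [folklore] -/
def or3P (g k : ℕ) (h : k + 2 < ncells ψ) : RailPlacement where
  k := 3
  K := 6
  m := 9
  Γ := RailOR3.Γ
  base := gbase ψ g
  ends r := gs (k + r.val) Slot.bS0
  ends_lt r := ⟨vtx_lt_gbase ψ (by omega) _ _, vtx_lt_gbase ψ (by omega) _ _⟩
  ends_ne _ he := absurd (GridCell.vtx_injective _ he) (by decide)
  ends_distinct r r' hrr := by
    have : k + r.val ≠ k + r'.val := fun h' => hrr (Fin.ext (by omega))
    simp only [gs, ne_eq, GridCell.vtx_inj]; tauto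

/-- `or3At?` is the named placement. [folklore] -/
theorem or3At?_eq_or3P {g k : ℕ} (h : k + 2 < ncells ψ) : or3At? ψ g k = some (or3P g k h) := by
  unfold or3At?; rw [dif_pos h]; rfl

/-- **The three-input OR placement, described.** [folklore] -/
theorem or3P_spec {g k : ℕ} (h : k + 2 < ncells ψ) :
    (or3P (ψ := ψ) g k h).VX = (Finset.range 27).image (gbase ψ g + ·) ∧
    (or3P (ψ := ψ) g k h).S = {gs k Slot.bS0, gs (k + 1) Slot.bS0, gs (k + 2) Slot.bS0} ∧
    ∀ a b, (or3P (ψ := ψ) g k h).GX.Adj a b ↔ ∃ p ∈ templatePairs RailOR3.Γ,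
      (a = or3Emb (gbase ψ g) k p.1 ∧ b = or3Emb (gbase ψ g) k p.2) ∨
      (a = or3Emb (gbase ψ g) k p.2 ∧ b = or3Emb (gbase ψ g) k p.1) := by
  have hemb : ∀ w, (or3P (ψ := ψ) g k h).embFun w = or3Emb (gbase ψ g) k w := by
    intro w; rcases w with ⟨r, t⟩ | ρ | ⟨r, _ | _⟩ <;> rfl
  refine ⟨?_, ?_, fun a b => ?_⟩
  · ext v
    rw [mem_VX_iff, Finset.mem_image]
    simp only [Finset.mem_range]
    show gbase ψ g ≤ v ∧ v < gbase ψ g + (3 * 6 + 9) ↔ _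
    constructor
    · rintro ⟨h1, h2⟩; exact ⟨v - gbase ψ g, by omega, by omega⟩
    · rintro ⟨i, hi, rfl⟩; omega
  · ext e
    rw [RailPlacement.mem_S_iff]
    simp only [Finset.mem_insert, Finset.mem_singleton]
    show (∃ r : Fin 3, e = gs (k + r.val) Slot.bS0) ↔ _
    constructor
    · rintro ⟨r, rfl⟩
      have : r.val = 0 ∨ r.val = 1 ∨ r.val = 2 := by omega
      rcases this with hr | hr | hr <;> simp [hr]
    · rintro (rfl | rfl | rfl)
      · exact ⟨0, by simp⟩
      · exact ⟨1, by simp⟩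
      · exact ⟨2, by simp⟩
  · rw [GX_adj_iff]
    simp only [hemb]
    rfl

end placementOr

/-! ### The abstract recipe of a tile, relative form (decided against the bundles)

What the abstract construction (`tileGad`, `gad`, `clauseGad`, `cellTyAt`, the chain) puts at a tile,
as a function of the bundle parameters alone: the gadgets anchored at the tile by family code, the
type and the slotted edges of each of its cells, and its connector edges. Checked by `decide` against
the chord, cell and connector data of the kinds of every bundle; related to the abstract definitions
tile by tile below. -/

section recipe

/-- A gadget anchored at a tile, relative form: an XOR-chord between two slots (tile offset, cell
position, slot ends), or the OR-gadget of the clause headed here. [folklore] -/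
inductive RelSpec
  | xor (r₁ r₂ : (ℤ × ℤ) × ℕ × (ℕ × ℕ))
  | or1
  | or3
  deriving DecidableEq

/-- The chord data a relative gadget of family code `f` must be drawn with. [folklore] -/
def RelSpec.toChordData (f : ℕ) : RelSpec → ChordData
  | xor r₁ r₂ => ⟨f, .xor, [r₁, r₂]⟩
  | or1 => ⟨f, .or1, [((0, 0), 0, (0, 1))]⟩
  | or3 => ⟨f, .or3, [((0, 0), 0, (0, 1)), ((0, 1), 0, (0, 1)), ((0, 2), 0, (0, 1))]⟩

namespace BSpec

/-- The column-leaving slot of a tile of the given kind (`colOutSlot`: `tS8` on a crossing, `bS1` on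
a tap; columns leave only taps and crossings), as vertex pairs. [folklore] -/
def colOut (tk : TK3) : ℕ × ℕ := if tk = .c then (11, 15) else (1, 2)

/-- **The gadget of family code `f` anchored at a tile** (`tileGad`: row `0`, inner `1–4`, column `5`;
`gad`: landing `6`; `clauseGad`: OR `7`, at the head terminal). [folklore] -/
def absGad : BSpec → ℕ → Option RelSpec
  | tile tk w _ ab, f =>
    if tk = .c then
      (if f = 0 then (if w then some (.xor ((0, -1), 2, (3, 7)) ((0, 0), 0, (0, 4))) else none)
       else if f = 1 then some (.xor ((0, 0), 0, (2, 3)) ((0, 0), 1, (8, 12)))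
       else if f = 2 then some (.xor ((0, 0), 0, (0, 1)) ((0, 0), 1, (2, 1)))
       else if f = 3 then some (.xor ((0, 0), 1, (15, 14)) ((0, 0), 2, (0, 4)))
       else if f = 4 then some (.xor ((0, 0), 0, (3, 7)) ((0, 0), 2, (13, 14)))
       else if f = 5 then some (.xor ((-1, 0), 1, colOut ab) ((0, 0), 0, (13, 14)))
       else none)
    else
      (if f = 0 then (if w then some (.xor ((0, -1), 2, (3, 7)) ((0, 0), 0, (9, 10))) else none)
       else if f = 1 then some (.xor ((0, 0), 0, (3, 7)) ((0, 0), 1, (9, 10)))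
       else if f = 2 then some (.xor ((0, 0), 1, (3, 7)) ((0, 0), 2, (9, 10)))
       else none)
  | clause land3 ab role e, f =>
    if f = 6 then some (.xor ((-1, 0), 1, colOut ab) ((0, 0), 0, (if land3 then (9, 10) else (0, 4))))
    else if f = 7 then (match role with | .or1 => some .or1 | .or3a => (if e then some .or3 else none) | _ => none)
    else none
  | doubler, _ => none

/-- **The cells of a tile**: the type and the slotted edges (as unordered vertex pairs) of the cell at
position `c`, if any. [folklore] -/
def absCell : BSpec → ℕ → Option (GridCell.CellTy × List (ℕ × ℕ))
  | tile tk w e _, c =>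
    if tk = .c then
      (if c = 0 then some (.pc, (if w then [(0, 4)] else []) ++ [(2, 3), (0, 1), (3, 7), (13, 14)])
       else if c = 1 then some (.pct, [(8, 12), (1, 2), (14, 15), (11, 15)])
       else if c = 2 then some (.pc, [(0, 4), (13, 14)] ++ (if e then [(3, 7)] else []))
       else none)
    else
      (if c = 0 then some (.bead, (if w then [(9, 10)] else []) ++ [(3, 7)])
       else if c = 1 then some (.bead, [(9, 10), (3, 7)] ++ (if tk = .t then [(1, 2)] else []))
       else if c = 2 then some (.bead, [(9, 10)] ++ (if e then [(3, 7)] else []))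
       else none)
  | clause land3 _ _ _, c => if c = 0 then some (.bead, [(if land3 then (9, 10) else (0, 4)), (0, 1)]) else none
  | doubler, c => if c = 2 then some (.bead, []) else none

/-- **The connector edges anchored at a tile**: (exited cell position, its type, column offset and
position of the entered cell). [folklore] -/
def absConns : BSpec → List (ℕ × GridCell.CellTy × ℤ × ℕ)
  | tile tk _ e _ =>
    (if tk = .c then [(0, .pc, 0, 1), (1, .pct, 0, 2)] else [(0, .bead, 0, 1), (1, .bead, 0, 2)]) ++
      (if e then [(2, (if tk = .c then .pc else .bead), 1, 0)] else [])
  | clause _ _ _ e => if e then [(0, .bead, 1, 0)] else []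
  | doubler => [(2, .bead, 1, 0)]

end BSpec

/-- Unordered comparison of slot lists. [folklore] -/
def slotSetEqB (l₁ : List (Fin 16 × Fin 16)) (l₂ : List (ℕ × ℕ)) : Bool :=
  (l₁.all fun e => l₂.contains (e.1.val, e.2.val) || l₂.contains (e.2.val, e.1.val)) &&
    (l₂.all fun e => (l₁.any fun e' => (e'.1.val, e'.2.val) == e || (e'.2.val, e'.1.val) == e))

/-- **The chords of every bundle are the gadgets of the recipe.** [folklore] -/
theorem chords_match : ∀ b ∈ BSpec.all, ∀ f < 8,
    (b.bundle.filterMap fun κ => (chordData κ).bind fun cd => if cd.f = f then some cd else none) =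
      ((b.absGad f).map (RelSpec.toChordData f)).toList := by
  decide +kernel

/-- **The cells of every bundle are the cells of the recipe** (position, type, slotted edges).
[folklore] -/
theorem cells_match : ∀ b ∈ BSpec.all, ∀ c < 3,
    (match (b.bundle.filterMap fun κ => (cellData κ).bind fun d => if d.2.1 = c then some (d.1, d.2.2) else none),
        b.absCell c with
      | [(ty, U)], some (ty', U') => decide (ty = ty') && slotSetEqB U U'
      | [], none => true
      | _, _ => false) = true := by
  decide +kernel

/-- **The connectors of every bundle are the connector edges of the recipe.** [folklore] -/
theorem conns_match : ∀ b ∈ BSpec.all, (b.bundle.filterMap connData) = b.absConns := by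
  decide +kernel

end recipe

/-! ### The recipe is the abstract construction: gadgets -/

section recipeGad

/-- A pair of local vertex numbers as a slot. [folklore] -/
def finPair (p : ℕ × ℕ) : Fin 16 × Fin 16 := (Fin.ofNat 16 p.1, Fin.ofNat 16 p.2)

/-- **The absolute specification of a relative gadget anchored at tile `(i, jj)`.** [folklore] -/
def RelSpec.toAbs (i jj : ℕ) : RelSpec → GadSpec
  | xor r₁ r₂ => .xor (cellAt ψ (i + r₁.1.1) (jj + r₁.1.2) r₁.2.1) (finPair r₁.2.2)
      (cellAt ψ (i + r₂.1.1) (jj + r₂.1.2) r₂.2.1) (finPair r₂.2.2)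
  | or1 => .or1 (cellAt ψ i jj 0)
  | or3 => .or3 (cellAt ψ i jj 0)

/-- The row wire leaves every tile through the edge `(3, 7)`. [folklore] -/
theorem rowOutSlot_eq (i j : ℕ) : rowOutSlot ψ i j = finPair (3, 7) := by
  unfold rowOutSlot; split_ifs <;> rfl

/-- The column wire leaves a non-empty tile through `colOut` of its kind. [folklore] -/
theorem colOutSlot_eq {i j : ℕ} (h : tileTy ψ i j ≠ .empty) : colOutSlot ψ i j = finPair (BSpec.colOut (tk3 ψ i j)) := by
  unfold colOutSlot BSpec.colOut tk3
  cases ht : tileTy ψ i j <;> simp_all <;> rfl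

/-- The landing slot read by `land3`. [folklore] -/
theorem landSlot_eq (j : ℕ) : landSlot ψ j = finPair (if land3 ψ j then (9, 10) else (0, 4)) := by
  unfold land3
  by_cases h : landSlot ψ j = Slot.bN3
  · rw [h, show decide (Slot.bN3 = Slot.bN3) = true from decide_eq_true rfl]; rfl
  · have h0 : landSlot ψ j = Slot.bN0 := by unfold landSlot at h ⊢; split_ifs at h ⊢ <;> simp_all
    rw [h0, show decide (Slot.bN0 = Slot.bN3) = false from rfl]; rfl

/-- Cells of the picture one column to the west / one row up, as `cellAt` of integer coordinates.
[folklore] -/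
theorem cellAt_west {i jj : ℕ} (hjj : 2 ≤ jj) (c : ℕ) :
    cellAt ψ ((i : ℤ) + 0) ((jj : ℤ) + -1) c = cellAt ψ i (jj - 1 : ℕ) c := by
  congr 1; omega

/-- The same, one row up. [folklore] -/
theorem cellAt_up {i jj : ℕ} (hi : 1 ≤ i) (c : ℕ) :
    cellAt ψ ((i : ℤ) + -1) ((jj : ℤ) + 0) c = cellAt ψ (i - 1 : ℕ) jj c := by
  congr 1; omega

/-- The same, in place. [folklore] -/
theorem cellAt_here (i jj c : ℕ) : cellAt ψ ((i : ℤ) + 0) ((jj : ℤ) + 0) c = cellAt ψ i jj c := by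
  congr 1

variable (hw : WidthOK ψ)
include hw

/-- **A gadget of the recipe of a tile is the abstract gadget of its index.** [folklore] -/
theorem gad_of_absGad {i jj : ℕ} (ht : (i, jj) ∈ tcoords ψ) {f : ℕ} {rs : RelSpec}
    (h : (bspecAt ψ i jj).absGad f = some rs) :
    gad ψ (gadAt ψ i jj f) = some (rs.toAbs (ψ := ψ) i jj) ∧ gadAt ψ i jj f < ngadgets ψ := by
  rcases tile_classes ht with ⟨rfl, rfl, hb⟩ | ⟨hi, hj, hj', hb⟩ | ⟨rfl, hj, hj', hV, hb⟩
  · rw [hb] at h; simp [BSpec.absGad] at h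
  · -- a tile row: `tileGad`
    rw [hb] at h
    have hjlt : jj - 1 < N ψ := by omega
    have htile : ∀ c, cellAt ψ i jj c = tileCell ψ i (jj - 1) c := fun c => by
      rw [cellAt_nat, if_neg (by omega), if_pos hi]
    simp only [BSpec.absGad] at h
    by_cases hc : tk3 ψ i (jj - 1) = .c
    · have hcross := (tk3_eq_c_iff (ψ := ψ)).1 hc
      have hi0 : 0 < i := by have := (tileTy_eq_cross_iff ψ).1 hcross; omega
      have hab : tileTy ψ (i - 1) (jj - 1) ≠ .empty :=
        tileTy_ne_empty_of_le ψ (by have := (tileTy_eq_cross_iff ψ).1 hcross; omega)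
      rw [if_pos hc] at h
      split_ifs at h with h0 hw2 h1 h2 h3 h4 h5
      all_goals
        simp only [Option.some.injEq] at h
        subst h
        first | subst h0 | subst h1 | subst h2 | subst h3 | subst h4 | subst h5
        rw [gadAt_nat, if_pos (by omega)]
        refine ⟨?_, tile_lt_ngadgets ψ hi hjlt (by omega)⟩
        rw [gad_tile ψ hi hjlt (by omega)]
        unfold tileGad
        rw [if_pos hcross]
        simp only [show (1:ℕ) ≠ 0 by decide, show (2:ℕ) ≠ 0 by decide, show (2:ℕ) ≠ 1 by decide,
          show (3:ℕ) ≠ 0 by decide, show (3:ℕ) ≠ 1 by decide, show (3:ℕ) ≠ 2 by decide, show (4:ℕ) ≠ 0 by decide,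
          show (4:ℕ) ≠ 1 by decide, show (4:ℕ) ≠ 2 by decide, show (4:ℕ) ≠ 3 by decide, show (5:ℕ) ≠ 0 by decide,
          show (5:ℕ) ≠ 1 by decide, show (5:ℕ) ≠ 2 by decide, show (5:ℕ) ≠ 3 by decide, show (5:ℕ) ≠ 4 by decide,
          ↓reduceIte, RelSpec.toAbs, cellAt_here, htile, Option.some.injEq]
      · -- row chord
        have hw2' : 2 ≤ jj := by simpa using hw2
        have hwest : cellAt ψ i (jj - 1 : ℕ) 2 = tileCell ψ i (jj - 1 - 1) 2 := by
          rw [cellAt_nat, if_neg (by omega), if_pos hi]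
        rw [if_neg (show ¬ jj - 1 = 0 by omega), rowOutSlot_eq, cellAt_west hw2', hwest]
        rfl
      · rfl
      · rfl
      · rfl
      · rfl
      · exfalso; omega
      · -- column chord
        have hup : cellAt ψ (i - 1 : ℕ) jj 1 = tileCell ψ (i - 1) (jj - 1) 1 := by
          rw [cellAt_nat, if_neg (by omega), if_pos (by omega)]
        rw [colOutSlot_eq hab, cellAt_up hi0, hup]
        rfl
    · have hncross : tileTy ψ i (jj - 1) ≠ .cross := fun hh => hc ((tk3_eq_c_iff (ψ := ψ)).2 hh)
      rw [if_neg hc] at h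
      split_ifs at h with h0 hw2 h1 h2
      all_goals
        simp only [Option.some.injEq] at h
        subst h
        first | subst h0 | subst h1 | subst h2
        rw [gadAt_nat, if_pos (by omega)]
        refine ⟨?_, tile_lt_ngadgets ψ hi hjlt (by omega)⟩
        rw [gad_tile ψ hi hjlt (by omega)]
        unfold tileGad
        rw [if_neg hncross]
        simp only [show (1:ℕ) ≠ 0 by decide, show (2:ℕ) ≠ 0 by decide, show (2:ℕ) ≠ 1 by decide,
          ↓reduceIte, RelSpec.toAbs, cellAt_here, htile, Option.some.injEq]
      · have hw2' : 2 ≤ jj := by simpa using hw2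
        have hwest : cellAt ψ i (jj - 1 : ℕ) 2 = tileCell ψ i (jj - 1 - 1) 2 := by
          rw [cellAt_nat, if_neg (by omega), if_pos hi]
        rw [if_neg (show ¬ jj - 1 = 0 by omega), rowOutSlot_eq, cellAt_west hw2', hwest]
        rfl
      · rfl
      · rfl
  · -- the clause row: `f = 6` (landing) or `f = 7` (OR at a head)
    rw [hb] at h
    simp only [BSpec.absGad] at h
    have hjlt : jj - 1 < N ψ := by omega
    have hV1 : V ψ - 1 < V ψ := by omega
    have hbead : cellAt ψ (V ψ) jj 0 = clauseBead ψ (jj - 1) := by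
      rw [cellAt_nat, if_neg (by omega), if_neg (lt_irrefl _)]
    have hup : cellAt ψ (V ψ - 1 : ℕ) jj 1 = tileCell ψ (V ψ - 1) (jj - 1) 1 := by
      rw [cellAt_nat, if_neg (by omega), if_pos hV1]
    by_cases h6 : f = 6
    · subst h6
      simp only [↓reduceIte, Option.some.injEq] at h
      subst h
      rw [gadAt_nat, if_neg (by omega), if_pos rfl]
      refine ⟨?_, land_lt_ngadgets ψ hjlt⟩
      rw [gad_land ψ hjlt]
      have hab : tileTy ψ (V ψ - 1) (jj - 1) ≠ .empty :=
        tileTy_ne_empty_of_le ψ (by have := rowOf_varOf_lt ψ hjlt; omega)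
      simp only [RelSpec.toAbs, cellAt_here, hbead, Option.some.injEq]
      rw [colOutSlot_eq hab, landSlot_eq, cellAt_up hV, hup]
    · rw [if_neg h6] at h
      by_cases h7 : f = 7
      · subst h7
        simp only [↓reduceIte] at h
        rw [gadAt_nat, if_neg (by omega), if_neg (by omega)]
        -- the head column of its clause
        obtain ⟨q, hq, m, hm, hjm⟩ := exists_cstart_add_of_lt hjlt
        have hrole := roleOf_cstart_add hq hm
        rw [← hjm] at hrole
        rcases hw q hq with h1 | h3
        · -- a one-literal clause
          have hm0 : m = 0 := by omega
          subst hm0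
          rw [h1] at hrole
          simp only [↓reduceIte] at hrole
          rw [hrole] at h
          simp only [Option.some.injEq] at h
          subst h
          have hcc : colClause ψ (jj - 1) = q := by rw [hjm]; simpa using colClause_cstart_add ψ hq hm
          rw [hcc, gad_clause]
          refine ⟨?_, clause_lt_ngadgets ψ hq⟩
          unfold clauseGad
          rw [dif_pos hq, if_pos h1]
          simp only [RelSpec.toAbs, hbead, Option.some.injEq]
          rw [hjm, Nat.add_zero]
        · rw [h3] at hrole
          simp only [show (3:ℕ) ≠ 1 by decide, ↓reduceIte] at hrole
          by_cases hm0 : m = 0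
          · subst hm0
            simp only [↓reduceIte] at hrole
            rw [hrole] at h
            by_cases he : jj < N ψ
            · simp only [he, decide_true, ↓reduceIte, Option.some.injEq] at h
              subst h
              have hcc : colClause ψ (jj - 1) = q := by rw [hjm]; simpa using colClause_cstart_add ψ hq hm
              rw [hcc, gad_clause]
              refine ⟨?_, clause_lt_ngadgets ψ hq⟩
              unfold clauseGad
              rw [dif_pos hq, if_neg (by omega), if_pos h3]
              simp only [RelSpec.toAbs, hbead, Option.some.injEq]
              rw [hjm, Nat.add_zero]
            · simp only [he, decide_false] at h; simp at h
          · exfalso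
            rw [if_neg hm0] at hrole
            split_ifs at hrole <;> rw [hrole] at h <;> simp at h
      · rw [if_neg h7] at h; simp at h

end recipeGad

section recipeGadDecode

variable (hw : WidthOK ψ) (hN : 0 < N ψ)
include hw hN

/-- **Every abstract gadget is a gadget of the recipe of its anchor tile.** [folklore] -/
theorem absGad_of_gad {g : ℕ} (hg : g < ngadgets ψ) {spec : GadSpec} (hs : gad ψ g = some spec) :
    ∃ i jj f rs, (i, jj) ∈ tcoords ψ ∧ gadAt ψ i jj f = g ∧ (bspecAt ψ i jj).absGad f = some rs ∧
      spec = rs.toAbs (ψ := ψ) i jj := by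
  -- it suffices to find the anchor with a nonempty recipe entry
  suffices key : ∃ i jj f, (i, jj) ∈ tcoords ψ ∧ gadAt ψ i jj f = g ∧ ((bspecAt ψ i jj).absGad f).isSome by
    obtain ⟨i, jj, f, ht, hgi, hsome⟩ := key
    obtain ⟨rs, hrs⟩ := Option.isSome_iff_exists.1 hsome
    refine ⟨i, jj, f, rs, ht, hgi, hrs, ?_⟩
    have := (gad_of_absGad hw ht hrs).1
    rw [hgi, hs] at this
    exact Option.some.inj this
  have hV : 0 < V ψ := V_pos_of_N_pos ψ hN
  rcases Nat.lt_or_ge g (8 * (V ψ * N ψ)) with h8 | h8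
  · -- a tile gadget
    obtain ⟨hi, hj, hgeq⟩ := decode_tile ψ h8
    set i := g / 8 / N ψ
    set j := g / 8 % N ψ
    set r := g % 8
    have hr8 : r < 8 := Nat.mod_lt _ (by decide)
    rw [hgeq, gad_tile ψ hi hj hr8] at hs
    have ht : (i, j + 1) ∈ tcoords ψ := (mem_tcoords_iff ψ).2 (Or.inr ⟨hi.le, by simp, by simpa using hj⟩)
    refine ⟨i, j + 1, r, ht, ?_, ?_⟩
    · rw [gadAt_nat, if_pos (by
        by_contra hr; unfold tileGad at hs; split_ifs at hs <;> omega)]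
      rw [hgeq]; simp
    · rw [bspecAt_tile hi (by simp)]
      simp only [Nat.add_sub_cancel, BSpec.absGad]
      unfold tileGad at hs
      by_cases hc : tileTy ψ i j = .cross
      · rw [if_pos hc] at hs
        rw [if_pos ((tk3_eq_c_iff (ψ := ψ)).2 hc)]
        split_ifs at hs with h0 hj0
        · rw [if_pos h0, if_pos (show decide (2 ≤ j + 1) = true by simp; omega)]; rfl
        all_goals simp_all
      · rw [if_neg hc] at hs
        rw [if_neg (fun hh => hc ((tk3_eq_c_iff (ψ := ψ)).1 hh))]
        split_ifs at hs with h0 hj0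
        · rw [if_pos h0, if_pos (show decide (2 ≤ j + 1) = true by simp; omega)]; rfl
        all_goals simp_all
  · rcases Nat.lt_or_ge g (8 * (V ψ * N ψ) + N ψ) with hl | hl
    · -- a landing chord
      set j := g - 8 * (V ψ * N ψ)
      have hj : j < N ψ := by omega
      have ht : (V ψ, j + 1) ∈ tcoords ψ := (mem_tcoords_iff ψ).2 (Or.inr ⟨le_rfl, by simp, by simpa using hj⟩)
      refine ⟨V ψ, j + 1, 6, ht, ?_, ?_⟩
      · rw [gadAt_nat, if_neg (by omega), if_pos rfl]; simp only [Nat.add_sub_cancel]; omega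
      · rw [bspecAt_clause (by simp)]; simp [BSpec.absGad]
    · -- a clause gadget, anchored at the head terminal
      set q := g - 8 * (V ψ * N ψ) - N ψ
      have hq : q < ψ.length := by unfold ngadgets at hg; omega
      have hgq : g = 8 * (V ψ * N ψ) + N ψ + q := by omega
      rw [hgq, gad_clause] at hs
      have hlen : 0 < ψ[q].length := by rcases hw q hq with h | h <;> omega
      have hcs : cstart ψ q < N ψ := by simpa using cstart_add_lt ψ hq hlen
      have ht : (V ψ, cstart ψ q + 1) ∈ tcoords ψ :=
        (mem_tcoords_iff ψ).2 (Or.inr ⟨le_rfl, by simp, by simpa using hcs⟩)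
      refine ⟨V ψ, cstart ψ q + 1, 7, ht, ?_, ?_⟩
      · rw [gadAt_nat, if_neg (by omega), if_neg (by omega)]
        simp only [Nat.add_sub_cancel]
        rw [show colClause ψ (cstart ψ q) = q by simpa using colClause_cstart_add ψ hq hlen, hgq]
      · rw [bspecAt_clause (by simp)]
        simp only [Nat.add_sub_cancel, BSpec.absGad, show (7:ℕ) ≠ 6 by decide, ↓reduceIte]
        have hrole := roleOf_cstart_add hq hlen
        simp only [Nat.add_zero] at hrole
        rcases hw q hq with h1 | h3
        · rw [h1] at hrole; simp only [↓reduceIte] at hrole; rw [hrole]; rfl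
        · rw [h3] at hrole; simp only [show (3:ℕ) ≠ 1 by decide, ↓reduceIte] at hrole; rw [hrole]
          have : cstart ψ q + 1 < N ψ := by have := cstart_add_lt ψ hq (m := 2) (by omega); omega
          simp [this]

end recipeGadDecode

/-! ### Chord objects draw the placed gadgets -/

section chordBridge

open RailGadget RailV

/-- **Sanity of the recipe's slots**: proper slot ends below `16`, the two rails of an XOR-chord in
different cells, cells at offsets `(0,0)`, `(0,-1)` (only with a west neighbour) or `(-1,0)` (only
on crossings and in the clause row), positions at most `2`. [folklore] -/
theorem absGad_ok : ∀ b ∈ BSpec.all, ∀ f < 8,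
    (match b.absGad f with
      | some (.xor r₁ r₂) =>
        decide (r₁.2.2.1 ≠ r₁.2.2.2 ∧ r₁.2.2.1 < 16 ∧ r₁.2.2.2 < 16 ∧ r₂.2.2.1 ≠ r₂.2.2.2 ∧ r₂.2.2.1 < 16 ∧ r₂.2.2.2 < 16 ∧
          (r₁.1, r₁.2.1) ≠ (r₂.1, r₂.2.1) ∧ r₁.2.1 ≤ 2 ∧ r₂.2.1 ≤ 2 ∧ r₂.1 = (0, 0)) &&
        (match b with
          | .tile tk w .. => decide (r₁.1 = (0, 0)) || (decide (r₁.1 = (0, -1)) && w) || (decide (r₁.1 = (-1, 0)) && decide (tk = .c))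
          | .clause .. => decide (r₁.1 = (-1, 0))
          | .doubler => false)
      | _ => true) = true := by
  decide +kernel

/-- Cells of genuine tiles determine the tile, and the position within a tile row. [folklore] -/
theorem cellAt_inj' {i jj c i' jj' c' : ℕ} (ht : (i, jj) ∈ tcoords ψ) (ht' : (i', jj') ∈ tcoords ψ) (hjj : 1 ≤ jj) (hjj' : 1 ≤ jj')
    (hc : c ≤ 2) (hc' : c' ≤ 2) (h : cellAt ψ i jj c = cellAt ψ i' jj' c') : i = i' ∧ jj = jj' ∧ (i < V ψ → c = c') := by
  have h1 := (mem_tcoords_iff ψ).1 ht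
  have h2 := (mem_tcoords_iff ψ).1 ht'
  simp only [Prod.mk.injEq] at h1 h2
  have e1 : cellAt ψ i jj c = if i < V ψ then tileCell ψ i (jj - 1) c else clauseBead ψ (jj - 1) := by
    rw [cellAt_nat, if_neg (by omega)]
  have e2 : cellAt ψ i' jj' c' = if i' < V ψ then tileCell ψ i' (jj' - 1) c' else clauseBead ψ (jj' - 1) := by
    rw [cellAt_nat, if_neg (by omega)]
  rw [e1, e2] at h
  by_cases hi : i < V ψ <;> by_cases hi' : i' < V ψ
  · rw [if_pos hi, if_pos hi'] at h
    have := tileCell_inj ψ (show jj - 1 < N ψ by omega) (show c < 3 by omega) (show jj' - 1 < N ψ by omega) (show c' < 3 by omega) h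
    omega
  · rw [if_pos hi, if_neg hi'] at h
    exact absurd h (tileCell_ne_clauseBead ψ hi (show jj - 1 < N ψ by omega) (show c < 3 by omega) _)
  · rw [if_neg hi, if_pos hi'] at h
    exact absurd h.symm (tileCell_ne_clauseBead ψ hi' (show jj' - 1 < N ψ by omega) (show c' < 3 by omega) _)
  · rw [if_neg hi, if_neg hi'] at h
    unfold clauseBead at h; omega

/-- Slot ends of the recipe, as local vertices. [folklore] -/
theorem finPair_val {p : ℕ × ℕ} (h1 : p.1 < 16) (h2 : p.2 < 16) : (finPair p).1.val = p.1 ∧ (finPair p).2.val = p.2 := by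
  simp [finPair, Fin.ofNat, Nat.mod_eq_of_lt h1, Nat.mod_eq_of_lt h2]

variable (hw : WidthOK ψ)
include hw

omit hw in
/-- The tile a rail of the recipe refers to exists and is a genuine tile. [folklore] -/
theorem rail_tile_mem {i jj : ℕ} (ht : (i, jj) ∈ tcoords ψ) {f : ℕ} {r₁ r₂ : (ℤ × ℤ) × ℕ × (ℕ × ℕ)}
    (h : (bspecAt ψ i jj).absGad f = some (.xor r₁ r₂)) :
    ∃ i₁ jj₁ : ℕ, ((i : ℤ) + r₁.1.1 = i₁ ∧ (jj : ℤ) + r₁.1.2 = jj₁) ∧ (i₁, jj₁) ∈ tcoords ψ ∧ 1 ≤ jj₁ ∧ 1 ≤ jj := by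
  have hf : f < 8 := by
    by_contra hf
    rcases tile_classes ht with ⟨-, -, hb⟩ | ⟨-, -, -, hb⟩ | ⟨-, -, -, -, hb⟩ <;> rw [hb] at h <;>
      simp [BSpec.absGad] at h <;> split_ifs at h <;> omega
  have hok := absGad_ok (bspecAt ψ i jj) (BSpec.mem_all _) f hf
  rw [h] at hok
  simp only [Bool.and_eq_true] at hok
  obtain ⟨-, hoff⟩ := hok
  rcases tile_classes ht with ⟨rfl, rfl, hb⟩ | ⟨hi, hj, hj', hb⟩ | ⟨rfl, hj, hj', hV, hb⟩
  · rw [hb] at h; simp [BSpec.absGad] at h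
  · rw [hb] at hoff
    simp only [Bool.or_eq_true, Bool.and_eq_true, decide_eq_true_eq] at hoff
    rcases hoff with (h0 | ⟨h0, hwst⟩) | ⟨h0, htk⟩
    · exact ⟨i, jj, by rw [h0]; simp, ht, hj, hj⟩
    · refine ⟨i, jj - 1, by rw [h0]; constructor <;> simp; omega, ?_, by omega, hj⟩
      exact (mem_tcoords_iff ψ).2 (Or.inr ⟨hi.le, by simp only; omega, by simp only; omega⟩)
    · have hcross := (tk3_eq_c_iff (ψ := ψ)).1 htk
      have hi0 : 0 < i := by have := (tileTy_eq_cross_iff ψ).1 hcross; omega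
      refine ⟨i - 1, jj, by rw [h0]; constructor <;> simp; omega, ?_, hj, hj⟩
      exact (mem_tcoords_iff ψ).2 (Or.inr ⟨by simp only; omega, hj, hj'⟩)
  · rw [hb] at hoff
    simp only [decide_eq_true_eq] at hoff
    refine ⟨V ψ - 1, jj, by rw [hoff]; constructor <;> simp; omega, ?_, hj, hj⟩
    exact (mem_tcoords_iff ψ).2 (Or.inr ⟨by simp only; omega, hj, hj'⟩)

/-- **The placement of an XOR-chord of the recipe.** [folklore] -/
theorem place_absGad_xor {i jj : ℕ} (ht : (i, jj) ∈ tcoords ψ) {f : ℕ} {r₁ r₂ : (ℤ × ℤ) × ℕ × (ℕ × ℕ)}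
    (h : (bspecAt ψ i jj).absGad f = some (.xor r₁ r₂)) :
    ∃ hg : cellAt ψ (i + r₁.1.1) (jj + r₁.1.2) r₁.2.1 < ncells ψ ∧ cellAt ψ (i + r₂.1.1) (jj + r₂.1.2) r₂.2.1 < ncells ψ ∧
        cellAt ψ (i + r₁.1.1) (jj + r₁.1.2) r₁.2.1 ≠ cellAt ψ (i + r₂.1.1) (jj + r₂.1.2) r₂.2.1 ∧
        (finPair r₁.2.2).1 ≠ (finPair r₁.2.2).2 ∧ (finPair r₂.2.2).1 ≠ (finPair r₂.2.2).2,
      place ψ (gadAt ψ i jj f) = some (xorP (gadAt ψ i jj f) _ (finPair r₁.2.2) _ (finPair r₂.2.2) hg) ∧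
      gadAt ψ i jj f < ngadgets ψ ∧
      r₁.2.2.1 < 16 ∧ r₁.2.2.2 < 16 ∧ r₂.2.2.1 < 16 ∧ r₂.2.2.2 < 16 := by
  have hf : f < 8 := by
    by_contra hf
    rcases tile_classes ht with ⟨-, -, hb⟩ | ⟨-, -, -, hb⟩ | ⟨-, -, -, -, hb⟩ <;> rw [hb] at h <;>
      simp [BSpec.absGad] at h <;> split_ifs at h <;> omega
  have hok := absGad_ok (bspecAt ψ i jj) (BSpec.mem_all _) f hf
  rw [h] at hok
  simp only [Bool.and_eq_true, decide_eq_true_eq] at hok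
  obtain ⟨⟨hne₁, ha₁, hb₁, hne₂, ha₂, hb₂, hcells, hc₁, hc₂, hr₂⟩, hoff⟩ := hok
  obtain ⟨i₁, jj₁, ⟨hi₁, hjj₁⟩, ht₁, hjj₁', hjj⟩ := rail_tile_mem ht h
  obtain ⟨hgad, hlt⟩ := gad_of_absGad hw ht h
  have hk₁ : cellAt ψ (i + r₁.1.1) (jj + r₁.1.2) r₁.2.1 = cellAt ψ i₁ jj₁ r₁.2.1 := by rw [hi₁, hjj₁]
  have hk₂ : cellAt ψ (i + r₂.1.1) (jj + r₂.1.2) r₂.2.1 = cellAt ψ i jj r₂.2.1 := by rw [hr₂]; exact cellAt_here i jj _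
  have hguard : cellAt ψ (i + r₁.1.1) (jj + r₁.1.2) r₁.2.1 < ncells ψ ∧ cellAt ψ (i + r₂.1.1) (jj + r₂.1.2) r₂.2.1 < ncells ψ ∧
      cellAt ψ (i + r₁.1.1) (jj + r₁.1.2) r₁.2.1 ≠ cellAt ψ (i + r₂.1.1) (jj + r₂.1.2) r₂.2.1 ∧
      (finPair r₁.2.2).1 ≠ (finPair r₁.2.2).2 ∧ (finPair r₂.2.2).1 ≠ (finPair r₂.2.2).2 := by
    refine ⟨by rw [hk₁]; exact cellAt_lt_ncells ht₁ hc₁, by rw [hk₂]; exact cellAt_lt_ncells ht hc₂, fun heq => ?_, ?_, ?_⟩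
    · rw [hk₁, hk₂] at heq
      obtain ⟨e1, e2, e3⟩ := cellAt_inj' ht₁ ht hjj₁' hjj hc₁ hc₂ heq
      subst e1; subst e2
      -- the first rail is then in place, hence a tile row, and the positions agree
      have h00 : r₁.1 = (0, 0) := Prod.ext (by omega) (by omega)
      rcases tile_classes ht with ⟨rfl, rfl, hb⟩ | ⟨hi, -, -, -⟩ | ⟨rfl, -, -, -, hb⟩
      · rw [hb] at h; simp [BSpec.absGad] at h
      · exact hcells (by rw [h00, hr₂, e3 hi])
      · rw [hb] at hoff; simp only [decide_eq_true_eq] at hoff; rw [hoff] at h00; simp at h00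
    · intro he; apply hne₁
      have := finPair_val ha₁ hb₁
      rw [← this.1, ← this.2, he]
    · intro he; apply hne₂
      have := finPair_val ha₂ hb₂
      rw [← this.1, ← this.2, he]
  refine ⟨hguard, ?_, hlt, ha₁, hb₁, ha₂, hb₂⟩
  rw [place, hgad]
  exact xorAt?_eq_xorP hguard

/-- **The placement of a one-input OR-gadget of the recipe.** [folklore] -/
theorem place_absGad_or1 {i jj : ℕ} (ht : (i, jj) ∈ tcoords ψ) {f : ℕ} (h : (bspecAt ψ i jj).absGad f = some .or1) :
    ∃ hg : cellAt ψ i jj 0 < ncells ψ,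
      place ψ (gadAt ψ i jj f) = some (or1P (gadAt ψ i jj f) (cellAt ψ i jj 0) hg) ∧ gadAt ψ i jj f < ngadgets ψ := by
  obtain ⟨hgad, hlt⟩ := gad_of_absGad hw ht h
  refine ⟨cellAt_lt_ncells ht (by omega), ?_, hlt⟩
  rw [place, hgad]
  exact or1At?_eq_or1P _

/-- **The placement of a three-input OR-gadget of the recipe.** [folklore] -/
theorem place_absGad_or3 {i jj : ℕ} (ht : (i, jj) ∈ tcoords ψ) {f : ℕ} (h : (bspecAt ψ i jj).absGad f = some .or3) :
    ∃ hg : cellAt ψ i jj 0 + 2 < ncells ψ,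
      place ψ (gadAt ψ i jj f) = some (or3P (gadAt ψ i jj f) (cellAt ψ i jj 0) hg) ∧ gadAt ψ i jj f < ngadgets ψ ∧
      i = V ψ ∧ jj + 2 ≤ N ψ := by
  obtain ⟨hgad, hlt⟩ := gad_of_absGad hw ht h
  -- only at an `or3a` head of the clause row
  rcases tile_classes ht with ⟨rfl, rfl, hb⟩ | ⟨hi, hj, hj', hb⟩ | ⟨rfl, hj, hj', hV, hb⟩
  · rw [hb] at h; simp [BSpec.absGad] at h
  · exfalso; rw [hb] at h; simp only [BSpec.absGad] at h; split_ifs at h <;> simp at h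
  · rw [hb] at h
    simp only [BSpec.absGad] at h
    split_ifs at h with h6 h7 <;> try simp at h
    all_goals
      have hrole : roleOf ψ (jj - 1) = .or3a := by
        revert h; cases roleOf ψ (jj - 1) <;> simp
      have hN2 := lt_N_of_roleOf_or3a hw (show jj - 1 < N ψ by omega) hrole
      have hk : cellAt ψ (V ψ) jj 0 = clauseBead ψ (jj - 1) := by rw [cellAt_nat, if_neg (by omega), if_neg (lt_irrefl _)]
      have hg : cellAt ψ (V ψ) jj 0 + 2 < ncells ψ := by
        rw [hk]; have := clauseBead_lt_ncells ψ (j := jj - 1 + 2) (by omega); unfold clauseBead at this ⊢; omega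
      refine ⟨hg, ?_, hlt, rfl, by omega⟩
      rw [place, hgad]
      exact or3At?_eq_or3P _

end chordBridge

section chordAdj

open RailGadget RailV

/-- **The chord kinds of a bundle are the gadgets of its recipe** (from `chords_match`): the data of
a chord kind present at a tile is the recipe's, … [folklore] -/
theorem rs_of_chordData {b : BSpec} (hb : b ∈ BSpec.all) {κ : Kind} (hκ : κ ∈ b.bundle) {cd : ChordData}
    (hcd : chordData κ = some cd) : ∃ rs, b.absGad cd.f = some rs ∧ cd = rs.toChordData cd.f := by
  have hf : cd.f < 8 := by revert hcd; cases κ <;> simp [chordData] <;> rintro rfl <;> decide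
  have hm := chords_match b hb cd.f hf
  have hmem : cd ∈ (b.bundle.filterMap fun κ => (chordData κ).bind fun cd' => if cd'.f = cd.f then some cd' else none) :=
    List.mem_filterMap.2 ⟨κ, hκ, by rw [hcd]; simp⟩
  rw [hm] at hmem
  cases hrs : b.absGad cd.f with
  | none => rw [hrs] at hmem; simp at hmem
  | some rs => rw [hrs] at hmem; simp at hmem; exact ⟨rs, rfl, hmem⟩

/-- … and every gadget of the recipe is drawn by a chord kind of the bundle. [folklore] -/
theorem chordData_of_rs {b : BSpec} (hb : b ∈ BSpec.all) {f : ℕ} (hf : f < 8) {rs : RelSpec} (hrs : b.absGad f = some rs) :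
    ∃ κ ∈ b.bundle, chordData κ = some (rs.toChordData f) := by
  have hm := chords_match b hb f hf
  rw [hrs] at hm
  have hmem : rs.toChordData f ∈ (b.bundle.filterMap fun κ => (chordData κ).bind fun cd' => if cd'.f = f then some cd' else none) := by
    rw [hm]; simp
  obtain ⟨κ, hκ, h⟩ := List.mem_filterMap.1 hmem
  refine ⟨κ, hκ, ?_⟩
  cases hcd : chordData κ with
  | none => rw [hcd] at h; simp at h
  | some cd =>
    rw [hcd] at h
    simp only [Option.bind_some] at h
    split_ifs at h with hff
    simp only [Option.some.injEq] at h
    rw [h]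

/-- A recipe entry has family code below `8`. [folklore] -/
theorem f_lt_of_absGad {b : BSpec} {f : ℕ} {rs : RelSpec} (h : b.absGad f = some rs) : f < 8 := by
  by_contra hf
  revert h; rcases b with ⟨tk, w, e, ab⟩ | ⟨l, ab, r, e⟩ | _ <;> simp [BSpec.absGad] <;> split_ifs <;> first | omega | simp

variable (hw : WidthOK ψ)
include hw

omit hw in
/-- **Names of the template vertices of an XOR-chord.** [folklore] -/
theorem oname_toRef_xor {i jj f : ℕ} {r₁ r₂ : (ℤ × ℤ) × ℕ × (ℕ × ℕ)}
    (hb : r₁.2.2.1 < 16 ∧ r₁.2.2.2 < 16 ∧ r₂.2.2.1 < 16 ∧ r₂.2.2.2 < 16) (κ : Kind) (w : RailV 2 4 4) :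
    oname ψ (κ, i, jj) (({ f := f, sh := GadShape.xor, rails := [r₁, r₂] } : ChordData).toRef w) =
      xorEmb (gbase ψ (gadAt ψ i jj f)) (gs (cellAt ψ (i + r₁.1.1) (jj + r₁.1.2) r₁.2.1) (finPair r₁.2.2))
        (gs (cellAt ψ (i + r₂.1.1) (jj + r₂.1.2) r₂.2.1) (finPair r₂.2.2)) w := by
  obtain ⟨h1, h2, h3, h4⟩ := hb
  rcases w with ⟨r, t⟩ | ρ | ⟨r, _ | _⟩
  · simp [oname, gname, ChordData.toRef, xorEmb, GadShape.K]
  · simp [oname, gname, ChordData.toRef, xorEmb, GadShape.K, GadShape.k]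
  · have hr : r.val = 0 ∨ r.val = 1 := by omega
    rcases hr with hr | hr <;>
      simp [oname, gname, ChordData.toRef, xorEmb, hr, gs, GridCell.vtx, finPair, Fin.ofNat,
        Nat.mod_eq_of_lt h2, Nat.mod_eq_of_lt h4] <;> ring
  · have hr : r.val = 0 ∨ r.val = 1 := by omega
    rcases hr with hr | hr <;>
      simp [oname, gname, ChordData.toRef, xorEmb, hr, gs, GridCell.vtx, finPair, Fin.ofNat,
        Nat.mod_eq_of_lt h1, Nat.mod_eq_of_lt h3] <;> ring

omit hw in
/-- **Names of the template vertices of a one-input OR-gadget.** [folklore] -/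
theorem oname_toRef_or1 {i jj f : ℕ} (κ : Kind) (w : RailV 1 2 1) :
    oname ψ (κ, i, jj) (({ f := f, sh := GadShape.or1, rails := [((0, 0), 0, (0, 1))] } : ChordData).toRef w) =
      or1Emb (gbase ψ (gadAt ψ i jj f)) (gs (cellAt ψ i jj 0) Slot.bS0) w := by
  rcases w with ⟨r, t⟩ | ρ | ⟨r, _ | _⟩
  · simp [oname, gname, ChordData.toRef, or1Emb, GadShape.K]
  · simp [oname, gname, ChordData.toRef, or1Emb, GadShape.K, GadShape.k]
  · simp [oname, gname, ChordData.toRef, or1Emb, gs, GridCell.vtx, Slot.bS0]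
  · simp [oname, gname, ChordData.toRef, or1Emb, gs, GridCell.vtx, Slot.bS0]

omit hw in
/-- **Names of the template vertices of a three-input OR-gadget** (at a head of the clause row).
[folklore] -/
theorem oname_toRef_or3 {jj f : ℕ} (hjj : 1 ≤ jj) (κ : Kind) (w : RailV 3 6 9) :
    oname ψ (κ, V ψ, jj) (({ f := f, sh := GadShape.or3, rails := [((0, 0), 0, (0, 1)), ((0, 1), 0, (0, 1)), ((0, 2), 0, (0, 1))] } : ChordData).toRef w) =
      or3Emb (gbase ψ (gadAt ψ (V ψ) jj f)) (cellAt ψ (V ψ) jj 0) w := by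
  have hk : cellAt ψ (V ψ) jj 0 = clauseBead ψ (jj - 1) := by
    rw [cellAt_nat, if_neg (by omega), if_neg (lt_irrefl _)]
  have hcell1 : cellAt ψ (V ψ) ((jj : ℤ) + 1) 0 = cellAt ψ (V ψ) jj 0 + 1 := by
    rw [show ((jj : ℤ) + 1) = ((jj + 1 : ℕ) : ℤ) by push_cast; ring,
      cellAt_nat, if_neg (by omega), if_neg (lt_irrefl _), hk]
    unfold clauseBead; omega
  have hcell2 : cellAt ψ (V ψ) ((jj : ℤ) + 2) 0 = cellAt ψ (V ψ) jj 0 + 2 := by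
    rw [show ((jj : ℤ) + 2) = ((jj + 2 : ℕ) : ℤ) by push_cast; ring,
      cellAt_nat, if_neg (by omega), if_neg (lt_irrefl _), hk]
    unfold clauseBead; omega
  rcases w with ⟨r, t⟩ | ρ | ⟨r, _ | _⟩
  · simp [oname, gname, ChordData.toRef, or3Emb, GadShape.K]
  · simp [oname, gname, ChordData.toRef, or3Emb, GadShape.K, GadShape.k]
  · fin_cases r
    · simp [oname, gname, ChordData.toRef, or3Emb, gs, GridCell.vtx, Slot.bS0]
    · simp [oname, gname, ChordData.toRef, or3Emb, gs, GridCell.vtx, Slot.bS0]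
      exact hcell1
    · simp [oname, gname, ChordData.toRef, or3Emb, gs, GridCell.vtx, Slot.bS0]
      exact hcell2
  · fin_cases r
    · simp [oname, gname, ChordData.toRef, or3Emb, gs, GridCell.vtx, Slot.bS0]
    · simp [oname, gname, ChordData.toRef, or3Emb, gs, GridCell.vtx, Slot.bS0]
      exact hcell1
    · simp [oname, gname, ChordData.toRef, or3Emb, gs, GridCell.vtx, Slot.bS0]
      exact hcell2

/-- **A chord object draws a placed gadget**: its abstract edges, under its name map, are exactly
the edges of the placed gadget of its index, and its abstract vertices the gadget's vertices.
[folklore] -/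
theorem chord_gadget {κ : Kind} {i jj : ℕ} (ho : ((κ, i, jj) : Obj) ∈ objs ψ) {cd : ChordData} (hcd : chordData κ = some cd) :
    gadAt ψ i jj cd.f < ngadgets ψ ∧
    (∀ a b, ((family ψ).GX (gadAt ψ i jj cd.f)).Adj a b ↔ ∃ q ∈ absEdges κ,
      (a = oname ψ (κ, i, jj) q.1 ∧ b = oname ψ (κ, i, jj) q.2) ∨ (a = oname ψ (κ, i, jj) q.2 ∧ b = oname ψ (κ, i, jj) q.1)) ∧
    (∀ v, v ∈ (family ψ).VX (gadAt ψ i jj cd.f) ↔ ∃ r ∈ absVerts κ, v = oname ψ (κ, i, jj) r) := by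
  obtain ⟨ht, hκ⟩ := (mem_objs_iff ψ).1 ho
  simp only at ht hκ
  obtain ⟨rs, hrs, hcdrs⟩ := rs_of_chordData (BSpec.mem_all _) hκ hcd
  have habs : absEdges κ = (templatePairs cd.sh.Γ).map fun p => (cd.toRef p.1, cd.toRef p.2) := by
    simp only [absEdges, hcd]
  have hverts : absVerts κ = (List.range (cd.sh.k * cd.sh.K + cd.sh.m)).map fun idx => Ref.gad 0 0 cd.f idx := by
    simp only [absVerts, hcd]
  clear hcd
  obtain ⟨f, sh, rails⟩ := cd
  simp only at hrs hcdrs habs hverts ⊢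
  rcases rs with ⟨r₁, r₂⟩ | _ | _
  · -- XOR-chord
    simp only [RelSpec.toChordData, ChordData.mk.injEq, true_and] at hcdrs
    obtain ⟨rfl, rfl⟩ := hcdrs
    obtain ⟨hg, hplace, hlt, hbnd⟩ := place_absGad_xor hw ht hrs
    obtain ⟨hVX, -, hGX⟩ := xorP_spec (ψ := ψ) (g := gadAt ψ i jj f) hg
    refine ⟨hlt, fun a b => ?_, fun v => ?_⟩
    · rw [family_GX, hplace]
      show (xorP _ _ _ _ _ hg).GX.Adj a b ↔ _
      rw [hGX, habs]
      simp only [List.mem_map]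
      constructor
      · rintro ⟨p, hp, h⟩
        refine ⟨_, ⟨p, hp, rfl⟩, ?_⟩
        simpa only [oname_toRef_xor (ψ := ψ) hbnd] using h
      · rintro ⟨_, ⟨p, hp, rfl⟩, h⟩
        refine ⟨p, hp, ?_⟩
        simpa only [oname_toRef_xor (ψ := ψ) hbnd] using h
    · rw [family_VX, hplace]
      show v ∈ (xorP _ _ _ _ _ hg).VX ↔ _
      rw [hVX, hverts]
      simp only [Finset.mem_image, Finset.mem_range, List.mem_map, List.mem_range, GadShape.k, GadShape.K, GadShape.m]
      constructor
      · rintro ⟨idx, hidx, rfl⟩; exact ⟨_, ⟨idx, hidx, rfl⟩, by simp [oname, gname]⟩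
      · rintro ⟨_, ⟨idx, hidx, rfl⟩, rfl⟩; exact ⟨idx, hidx, by simp [oname, gname]⟩
  · -- one-input OR
    simp only [RelSpec.toChordData, ChordData.mk.injEq, true_and] at hcdrs
    obtain ⟨rfl, rfl⟩ := hcdrs
    obtain ⟨hg, hplace, hlt⟩ := place_absGad_or1 hw ht hrs
    obtain ⟨hVX, -, hGX⟩ := or1P_spec (ψ := ψ) (g := gadAt ψ i jj f) hg
    refine ⟨hlt, fun a b => ?_, fun v => ?_⟩
    · rw [family_GX, hplace]
      show (or1P _ _ hg).GX.Adj a b ↔ _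
      rw [hGX, habs]
      simp only [List.mem_map]
      constructor
      · rintro ⟨p, hp, h⟩
        refine ⟨_, ⟨p, hp, rfl⟩, ?_⟩
        simpa only [oname_toRef_or1 (ψ := ψ)] using h
      · rintro ⟨_, ⟨p, hp, rfl⟩, h⟩
        refine ⟨p, hp, ?_⟩
        simpa only [oname_toRef_or1 (ψ := ψ)] using h
    · rw [family_VX, hplace]
      show v ∈ (or1P _ _ hg).VX ↔ _
      rw [hVX, hverts]
      simp only [Finset.mem_image, Finset.mem_range, List.mem_map, List.mem_range, GadShape.k, GadShape.K, GadShape.m]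
      constructor
      · rintro ⟨idx, hidx, rfl⟩; exact ⟨_, ⟨idx, hidx, rfl⟩, by simp [oname, gname]⟩
      · rintro ⟨_, ⟨idx, hidx, rfl⟩, rfl⟩; exact ⟨idx, hidx, by simp [oname, gname]⟩
  · -- three-input OR
    simp only [RelSpec.toChordData, ChordData.mk.injEq, true_and] at hcdrs
    obtain ⟨rfl, rfl⟩ := hcdrs
    obtain ⟨hg, hplace, hlt, hi, hjj2⟩ := place_absGad_or3 hw ht hrs
    subst hi
    have hjj : 1 ≤ jj := by
      have := (mem_tcoords_iff ψ).1 ht; simp only [Prod.mk.injEq] at this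
      rcases this with ⟨h0, -⟩ | ⟨-, h1, -⟩
      · have := V_pos_of_N_pos ψ (by omega); omega
      · exact h1
    obtain ⟨hVX, -, hGX⟩ := or3P_spec (ψ := ψ) (g := gadAt ψ (V ψ) jj f) hg
    refine ⟨hlt, fun a b => ?_, fun v => ?_⟩
    · rw [family_GX, hplace]
      show (or3P _ _ hg).GX.Adj a b ↔ _
      rw [hGX, habs]
      simp only [List.mem_map]
      constructor
      · rintro ⟨p, hp, h⟩
        refine ⟨_, ⟨p, hp, rfl⟩, ?_⟩
        simpa only [oname_toRef_or3 (ψ := ψ) hjj] using h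
      · rintro ⟨_, ⟨p, hp, rfl⟩, h⟩
        refine ⟨p, hp, ?_⟩
        simpa only [oname_toRef_or3 (ψ := ψ) hjj] using h
    · rw [family_VX, hplace]
      show v ∈ (or3P _ _ hg).VX ↔ _
      rw [hVX, hverts]
      simp only [Finset.mem_image, Finset.mem_range, List.mem_map, List.mem_range, GadShape.k, GadShape.K, GadShape.m]
      constructor
      · rintro ⟨idx, hidx, rfl⟩; exact ⟨_, ⟨idx, hidx, rfl⟩, by simp [oname, gname]⟩
      · rintro ⟨_, ⟨idx, hidx, rfl⟩, rfl⟩; exact ⟨idx, hidx, by simp [oname, gname]⟩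

end chordAdj

/-! ### Slots: the slotted edges of the cells are the slots of the gadgets -/

section slots

/-- The tile kind of the tile above, as recorded in the bundle parameters. [folklore] -/
def BSpec.aboveOf : BSpec → TK3
  | .tile _ _ _ ab => ab
  | .clause _ ab _ _ => ab
  | .doubler => .e

/-- **Foreign rails of the recipe**: a rail one column to the west is the row wire's exit `(3, 7)` of
cell `2` (family `0`); a rail one row up is the column wire's exit of cell `1` of the tile above
(families `5`, `6`). [folklore] -/
theorem absGad_ok2 : ∀ b ∈ BSpec.all, ∀ f < 8,
    (match b.absGad f with
      | some (.xor r₁ _) =>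
        decide ((r₁.1 = (0, -1) → r₁.2.1 = 2 ∧ r₁.2.2 = (3, 7) ∧ f = 0) ∧
          (r₁.1 = (-1, 0) → r₁.2.1 = 1 ∧ r₁.2.2 = BSpec.colOut b.aboveOf ∧ (f = 5 ∨ f = 6)))
      | _ => true) = true := by
  decide +kernel

namespace BSpec

/-- The slots of the own gadgets of a tile in its cell at position `c`. [folklore] -/
def ownRails (b : BSpec) (c : ℕ) : List (ℕ × ℕ) :=
  (List.range 8).flatMap fun f =>
    match b.absGad f with
    | some (.xor r₁ r₂) => [r₁, r₂].filterMap fun r => if r.1 = (0, 0) ∧ r.2.1 = c then some r.2.2 else none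
    | some .or1 => if c = 0 then [(0, 1)] else []
    | some .or3 => if c = 0 then [(0, 1)] else []
    | none => []

/-- The slots of neighbouring tiles' gadgets in the cell at position `c`: the row wire's exit (east
neighbour's row chord), the column wire's exit (the chord of the tile below), the bottom slot of a
non-head terminal (the OR-gadget of its head). [folklore] -/
def extraRails (b : BSpec) (c : ℕ) : List (ℕ × ℕ) :=
  match b with
  | tile tk _ e _ => (if c = 2 ∧ e = true then [(3, 7)] else []) ++ (if c = 1 ∧ tk ≠ .e then [colOut tk] else [])
  | clause _ _ role e => if c = 0 then (match role with | .or3b | .or3c => [(0, 1)] | .or3a => (if e then [] else [(0, 1)]) | _ => []) else []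
  | doubler => []

end BSpec

/-- Unordered comparison of slot lists over `ℕ`. [folklore] -/
def slotSetEqNB (l₁ l₂ : List (ℕ × ℕ)) : Bool :=
  (l₁.all fun e => l₂.contains e || l₂.contains e.swap) && (l₂.all fun e => l₁.contains e || l₁.contains e.swap)

/-- **The slotted edges of the cells of the recipe are the own and the neighbours' rails.**
[folklore] -/
theorem slots_spec : ∀ b ∈ BSpec.all, ∀ c < 3,
    (match b.absCell c with
      | some (_, U) => slotSetEqNB U (b.ownRails c ++ b.extraRails c)
      | none => true) = true := by
  decide +kernel

/-- Membership in the own rails, unfolded. [folklore] -/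
theorem mem_ownRails_iff {b : BSpec} {c : ℕ} {p : ℕ × ℕ} : p ∈ b.ownRails c ↔
    ∃ f < 8, (∃ r₁ r₂, b.absGad f = some (.xor r₁ r₂) ∧ (((0, 0), c, p) = r₁ ∨ ((0, 0), c, p) = r₂)) ∨
      (c = 0 ∧ p = (0, 1) ∧ (b.absGad f = some .or1 ∨ b.absGad f = some .or3)) := by
  unfold BSpec.ownRails
  simp only [List.mem_flatMap, List.mem_range]
  constructor
  · rintro ⟨f, hf, h⟩
    refine ⟨f, hf, ?_⟩
    cases hg : b.absGad f with
    | none => rw [hg] at h; simp at h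
    | some rs =>
      rw [hg] at h
      rcases rs with ⟨r₁, r₂⟩ | _ | _
      · simp only [List.mem_filterMap, List.mem_cons, List.not_mem_nil, or_false] at h
        obtain ⟨⟨o, c', p'⟩, hr, h⟩ := h
        simp only at h
        split_ifs at h with hc
        simp only [Option.some.injEq] at h
        obtain ⟨rfl, rfl⟩ := hc
        subst h
        left
        refine ⟨r₁, r₂, rfl, ?_⟩
        rcases hr with h | h
        · exact Or.inl h
        · exact Or.inr h
      · simp only at h; split_ifs at h with hc <;> simp at h; exact Or.inr ⟨hc, h, Or.inl rfl⟩
      · simp only at h; split_ifs at h with hc <;> simp at h; exact Or.inr ⟨hc, h, Or.inr rfl⟩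
  · rintro ⟨f, hf, ⟨r₁, r₂, hg, h⟩ | ⟨hc, rfl, hg | hg⟩⟩
    · refine ⟨f, hf, ?_⟩
      rw [hg]
      simp only [List.mem_filterMap, List.mem_cons, List.not_mem_nil, or_false]
      rcases h with rfl | rfl
      · exact ⟨_, Or.inl rfl, by simp⟩
      · exact ⟨_, Or.inr rfl, by simp⟩
    · exact ⟨f, hf, by rw [hg]; simp [hc]⟩
    · exact ⟨f, hf, by rw [hg]; simp [hc]⟩

variable (hw : WidthOK ψ) (hN : 0 < N ψ)
include hw hN

omit hN in
/-- The bundle parameters read by the extra rails. [folklore] -/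
theorem extraRails_bspecAt {i jj : ℕ} (ht : (i, jj) ∈ tcoords ψ) (hjj : 1 ≤ jj) {c : ℕ} {p : ℕ × ℕ} :
    p ∈ (bspecAt ψ i jj).extraRails c ↔
      (i < V ψ ∧ ((c = 2 ∧ jj < N ψ ∧ p = (3, 7)) ∨ (c = 1 ∧ tk3 ψ i (jj - 1) ≠ .e ∧ p = BSpec.colOut (tk3 ψ i (jj - 1))))) ∨
      (i = V ψ ∧ c = 0 ∧ p = (0, 1) ∧ (roleOf ψ (jj - 1) = .or3b ∨ roleOf ψ (jj - 1) = .or3c)) := by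
  rcases tile_classes ht with ⟨-, rfl, -⟩ | ⟨hi, -, hj', hb⟩ | ⟨rfl, -, hj', hV, hb⟩
  · omega
  · rw [hb]
    simp only [BSpec.extraRails, decide_eq_true_eq, List.mem_append, hi, true_and]
    constructor
    · rintro (h | h)
      · split_ifs at h with h1 <;> simp at h; exact Or.inl (Or.inl ⟨h1.1, h1.2, h⟩)
      · split_ifs at h with h1 <;> simp at h; exact Or.inl (Or.inr ⟨h1.1, h1.2, h⟩)
    · rintro ((⟨hc, hlt, rfl⟩ | ⟨hc, hne, rfl⟩) | ⟨hV, -⟩)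
      · left; rw [if_pos ⟨hc, hlt⟩]; simp
      · right; rw [if_pos ⟨hc, hne⟩]; simp
      · omega
  · rw [hb]
    simp only [BSpec.extraRails, lt_irrefl, false_and, false_or, true_and]
    have hor3a : roleOf ψ (jj - 1) = .or3a → jj < N ψ := fun h => by
      have := lt_N_of_roleOf_or3a hw (show jj - 1 < N ψ by omega) h; omega
    constructor
    · intro h
      by_cases hc : c = 0
      · rw [if_pos hc] at h
        cases hr : roleOf ψ (jj - 1) <;> rw [hr] at h
        · simp at h
        · have := hor3a hr
          simp [this] at h
        · simp at h; exact ⟨hc, h, Or.inl rfl⟩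
        · simp at h; exact ⟨hc, h, Or.inr rfl⟩
      · rw [if_neg hc] at h; simp at h
    · rintro ⟨hc, rfl, hr | hr⟩ <;> rw [if_pos hc, hr] <;> simp

/-- **The slots in a cell of the picture**, oriented: exactly the own rails and the neighbours'
rails of the recipe at that position. [folklore] -/
theorem isSlot_iff {i jj : ℕ} (ht : (i, jj) ∈ tcoords ψ) (hjj : 1 ≤ jj) {c : ℕ} (hc : c ≤ 2) (hcl : i = V ψ → c = 0)
    (e₀ : Fin 16 × Fin 16) :
    (∃ g < ngadgets ψ, gs (cellAt ψ i jj c) e₀ ∈ (family ψ).S g) ↔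
      ∃ p, (p ∈ (bspecAt ψ i jj).ownRails c ∨ p ∈ (bspecAt ψ i jj).extraRails c) ∧ p.1 < 16 ∧ p.2 < 16 ∧ e₀ = finPair p := by
  have hV : 0 < V ψ := V_pos_of_N_pos ψ hN
  have htc := (mem_tcoords_iff ψ).1 ht
  simp only [Prod.mk.injEq] at htc
  have hiV : i ≤ V ψ := by omega
  have hjN : jj ≤ N ψ := by omega
  constructor
  · rintro ⟨g, hg, hS⟩
    -- the gadget is placed, with a specification, anchored at a tile of the recipe
    have hplace : ∃ P, place ψ g = some P := by
      rw [family_S] at hS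
      cases hP : place ψ g with
      | none => rw [hP] at hS; simp at hS
      | some P => exact ⟨P, rfl⟩
    obtain ⟨P, hP⟩ := hplace
    have hspec : ∃ spec, gad ψ g = some spec := by
      unfold place at hP
      cases hs : gad ψ g with
      | none => rw [hs] at hP; simp at hP
      | some spec => exact ⟨spec, rfl⟩
    obtain ⟨spec, hs⟩ := hspec
    obtain ⟨i', jj', f, rs, ht', hg', hrs, hspec⟩ := absGad_of_gad hw hN hg hs
    have hf := f_lt_of_absGad hrs
    have htc' := (mem_tcoords_iff ψ).1 ht'
    simp only [Prod.mk.injEq] at htc'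
    rw [← hg'] at hS
    rcases rs with ⟨r₁, r₂⟩ | _ | _
    · -- an XOR-chord: one of its two rails
      obtain ⟨hguard, hpl, -, hb1, hb2, hb3, hb4⟩ := place_absGad_xor hw ht' hrs
      obtain ⟨-, hSeq, -⟩ := xorP_spec (ψ := ψ) (g := gadAt ψ i' jj' f) hguard
      rw [family_S, hpl] at hS
      change gs (cellAt ψ i jj c) e₀ ∈ (xorP _ _ _ _ _ hguard).S at hS
      rw [hSeq, Finset.mem_insert, Finset.mem_singleton] at hS
      obtain ⟨i₁, jj₁, ⟨hi₁, hjj₁⟩, ht₁, hjj₁', hjj'⟩ := rail_tile_mem ht' hrs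
      have hok := absGad_ok (bspecAt ψ i' jj') (BSpec.mem_all _) f hf
      have hok2 := absGad_ok2 (bspecAt ψ i' jj') (BSpec.mem_all _) f hf
      rw [hrs] at hok hok2
      simp only [Bool.and_eq_true, decide_eq_true_eq] at hok hok2
      obtain ⟨⟨-, -, -, -, -, -, -, hc₁, hc₂, hr₂⟩, hoff⟩ := hok
      obtain ⟨hwest, hup⟩ := hok2
      rcases hS with h | h
      · -- the first rail
        obtain ⟨hk, he⟩ := (gs_inj).1 h
        have hk₁ : cellAt ψ (i' + r₁.1.1) (jj' + r₁.1.2) r₁.2.1 = cellAt ψ i₁ jj₁ r₁.2.1 := by rw [hi₁, hjj₁]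
        rw [hk₁] at hk
        obtain ⟨e1, e2, e3⟩ := cellAt_inj' ht ht₁ hjj hjj₁' hc hc₁ hk
        subst e1; subst e2
        refine ⟨r₁.2.2, ?_, hb1, hb2, he⟩
        -- which tile offset?
        rcases tile_classes ht' with ⟨rfl, rfl, hb⟩ | ⟨hi'', hj'', -, hb⟩ | ⟨rfl, hj'', -, -, hb⟩
        · rw [hb] at hrs; simp [BSpec.absGad] at hrs
        · rw [hb] at hoff hup
          simp only [Bool.or_eq_true, Bool.and_eq_true, decide_eq_true_eq] at hoff
          rcases hoff with (h0 | ⟨h0, -⟩) | ⟨h0, htk⟩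
          · -- own rail
            have hii : i = i' := by have := hi₁; rw [h0] at this; simp at this; omega
            have hjj2 : jj = jj' := by have := hjj₁; rw [h0] at this; simp at this; omega
            subst hii; subst hjj2
            left
            rw [mem_ownRails_iff]
            refine ⟨f, hf, Or.inl ⟨r₁, r₂, hrs, Or.inl ?_⟩⟩
            rw [← h0, e3 hi'']
          · -- a rail one column to the west of `(i', jj')`: our tile is the west neighbour
            obtain ⟨hc2, hp, -⟩ := hwest h0
            have hii : i = i' := by have := hi₁; rw [h0] at this; simp at this; omega
            have hjj2 : jj' = jj + 1 := by have := hjj₁; rw [h0] at this; simp at this; omega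
            subst hii
            right
            rw [extraRails_bspecAt hw ht hjj]
            exact Or.inl ⟨hi'', Or.inl ⟨by rw [e3 hi'', hc2], by omega, hp⟩⟩
          · -- a rail one row up: our tile is above the cross tile `(i', jj')`
            obtain ⟨hc2, hp, -⟩ := hup h0
            have hii : i' = i + 1 := by have := hi₁; rw [h0] at this; simp at this; omega
            have hjj2 : jj = jj' := by have := hjj₁; rw [h0] at this; simp at this; omega
            subst hjj2
            have hiV' : i < V ψ := by omega
            right
            rw [extraRails_bspecAt hw ht hjj]
            have hab : BSpec.aboveOf (BSpec.tile (tk3 ψ i' (jj - 1)) (decide (2 ≤ jj)) (decide (jj < N ψ))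
                (if i' = 0 then TK3.e else tk3 ψ (i' - 1) (jj - 1))) = tk3 ψ i (jj - 1) := by
              simp only [BSpec.aboveOf]; rw [if_neg (by omega), hii]; rfl
            rw [hab] at hp
            have hne : tk3 ψ i (jj - 1) ≠ .e := by
              have hcross := (tk3_eq_c_iff (ψ := ψ)).1 htk
              have := (tileTy_eq_cross_iff ψ).1 hcross
              intro hE
              have hem : tileTy ψ i (jj - 1) = .empty := by
                revert hE; unfold tk3; cases tileTy ψ i (jj - 1) <;> simp
              have := (tileTy_eq_empty_iff ψ).1 hem
              omega
            exact Or.inl ⟨hiV', Or.inr ⟨by rw [e3 hiV', hc2], hne, hp⟩⟩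
        · rw [hb] at hoff hup
          simp only [decide_eq_true_eq] at hoff
          obtain ⟨hc2, hp, -⟩ := hup hoff
          have hii : i + 1 = V ψ := by have := hi₁; rw [hoff] at this; simp at this; omega
          have hjj2 : jj = jj' := by have := hjj₁; rw [hoff] at this; simp at this; omega
          subst hjj2
          have hiV' : i < V ψ := by omega
          right
          rw [extraRails_bspecAt hw ht hjj]
          simp only [BSpec.aboveOf] at hp
          rw [show V ψ - 1 = i by omega] at hp
          have hne : tk3 ψ i (jj - 1) ≠ .e := by
            intro hE
            have hem : tileTy ψ i (jj - 1) = .empty := by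
              revert hE; unfold tk3; cases tileTy ψ i (jj - 1) <;> simp
            have := (tileTy_eq_empty_iff ψ).1 hem
            have := rowOf_varOf_lt ψ (show jj - 1 < N ψ by omega)
            omega
          exact Or.inl ⟨hiV', Or.inr ⟨by rw [e3 hiV', hc2], hne, hp⟩⟩
      · -- the second rail: always in place
        obtain ⟨hk, he⟩ := (gs_inj).1 h
        have hk₂ : cellAt ψ (i' + r₂.1.1) (jj' + r₂.1.2) r₂.2.1 = cellAt ψ i' jj' r₂.2.1 := by rw [hr₂]; exact cellAt_here _ _ _
        rw [hk₂] at hk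
        obtain ⟨e1, e2, e3⟩ := cellAt_inj' ht ht' hjj hjj' hc hc₂ hk
        subst e1; subst e2
        refine ⟨r₂.2.2, Or.inl ?_, hb3, hb4, he⟩
        rw [mem_ownRails_iff]
        refine ⟨f, hf, Or.inl ⟨r₁, r₂, hrs, Or.inr ?_⟩⟩
        rcases Nat.lt_or_ge i (V ψ) with hiV' | hiV'
        · rw [← hr₂, e3 hiV']
        · have hi : i = V ψ := by omega
          rw [hcl hi, ← hr₂]
          -- in the clause row the in-place rail is in cell `0`
          rcases tile_classes ht' with ⟨h0, -, -⟩ | ⟨hi'', -, -, -⟩ | ⟨-, -, -, -, hb⟩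
          · omega
          · omega
          · rw [hb] at hrs; simp only [BSpec.absGad] at hrs
            by_cases h6 : f = 6
            · rw [if_pos h6] at hrs
              simp only [Option.some.injEq, RelSpec.xor.injEq] at hrs
              obtain ⟨-, rfl⟩ := hrs; rfl
            · rw [if_neg h6] at hrs
              exfalso
              by_cases h7 : f = 7
              · rw [if_pos h7] at hrs
                revert hrs; cases roleOf ψ (jj - 1) <;> simp
              · rw [if_neg h7] at hrs; simp at hrs
    · -- a one-input OR-gadget: its own terminal
      have hjj' : 1 ≤ jj' := by
        rcases htc' with ⟨h0, h0'⟩ | ⟨-, h1, -⟩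
        · exfalso; subst h0; subst h0'; rw [bspecAt_zero_zero] at hrs; simp [BSpec.absGad] at hrs
        · exact h1
      obtain ⟨hguard, hpl, -⟩ := place_absGad_or1 hw ht' hrs
      obtain ⟨-, hSeq, -⟩ := or1P_spec (ψ := ψ) (g := gadAt ψ i' jj' f) hguard
      rw [family_S, hpl] at hS
      change gs (cellAt ψ i jj c) e₀ ∈ (or1P _ _ hguard).S at hS
      rw [hSeq, Finset.mem_singleton] at hS
      obtain ⟨hk, he⟩ := (gs_inj).1 hS
      obtain ⟨e1, e2, e3⟩ := cellAt_inj' ht ht' hjj hjj' hc (by omega) hk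
      subst e1; subst e2
      refine ⟨(0, 1), Or.inl ?_, by omega, by omega, by rw [he]; rfl⟩
      rw [mem_ownRails_iff]
      have hc0 : c = 0 := by
        rcases Nat.lt_or_ge i (V ψ) with hiV' | hiV'
        · exact e3 hiV'
        · exact hcl (by omega)
      exact ⟨f, hf, Or.inr ⟨hc0, rfl, Or.inl hrs⟩⟩
    · -- a three-input OR-gadget: one of its three terminals
      obtain ⟨hguard, hpl, -, hi', hjj2⟩ := place_absGad_or3 hw ht' hrs
      obtain ⟨-, hSeq, -⟩ := or3P_spec (ψ := ψ) (g := gadAt ψ i' jj' f) hguard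
      rw [family_S, hpl] at hS
      change gs (cellAt ψ i jj c) e₀ ∈ (or3P _ _ hguard).S at hS
      rw [hSeq, Finset.mem_insert, Finset.mem_insert, Finset.mem_singleton] at hS
      subst hi'
      have hjj' : 1 ≤ jj' := by
        rcases htc' with ⟨h0, -⟩ | ⟨-, h1, -⟩
        · omega
        · exact h1
      have hk' : ∀ r : ℕ, r ≤ 2 → cellAt ψ (V ψ) jj' 0 + r = cellAt ψ (V ψ) ((jj' + r : ℕ)) 0 := by
        intro r hr
        rw [cellAt_nat, if_neg (by omega), if_neg (lt_irrefl _), cellAt_nat, if_neg (by omega), if_neg (lt_irrefl _)]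
        unfold clauseBead; omega
      have key : ∀ r : ℕ, r ≤ 2 → gs (cellAt ψ i jj c) e₀ = gs (cellAt ψ (V ψ) jj' 0 + r) Slot.bS0 →
          ∃ p, (p ∈ (bspecAt ψ i jj).ownRails c ∨ p ∈ (bspecAt ψ i jj).extraRails c) ∧ p.1 < 16 ∧ p.2 < 16 ∧ e₀ = finPair p := by
        intro r hr h
        rw [hk' r hr] at h
        obtain ⟨hk, he⟩ := (gs_inj).1 h
        have ht'' : (V ψ, jj' + r) ∈ tcoords ψ := (mem_tcoords_iff ψ).2 (Or.inr ⟨le_rfl, by simp only; omega, by simp only; omega⟩)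
        rw [show (((jj' + r : ℕ)) : ℤ) = ((jj' + r : ℕ) : ℤ) from rfl] at hk
        obtain ⟨e1, e2, -⟩ := cellAt_inj' ht ht'' hjj (by omega) hc (by omega) hk
        subst e1; subst e2
        have hc0 : c = 0 := hcl rfl
        subst hc0
        refine ⟨(0, 1), ?_, by omega, by omega, by rw [he]; rfl⟩
        rcases Nat.eq_zero_or_pos r with rfl | hrpos
        · left; rw [mem_ownRails_iff]; exact ⟨f, hf, Or.inr ⟨rfl, rfl, Or.inr hrs⟩⟩
        · right
          rw [extraRails_bspecAt hw ht (by omega)]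
          refine Or.inr ⟨rfl, rfl, rfl, ?_⟩
          -- the role of a later terminal of the clause headed at `jj' - 1`
          have hb := bspecAt_clause (ψ := ψ) (jj := jj') hjj'
          rw [hb] at hrs
          simp only [BSpec.absGad] at hrs
          split_ifs at hrs with h6 h7 <;> try simp at hrs
          all_goals
            have hrole : roleOf ψ (jj' - 1) = .or3a := by revert hrs; cases roleOf ψ (jj' - 1) <;> simp
            obtain ⟨q, hq, m, hm, hjm⟩ := exists_cstart_add_of_lt (show jj' - 1 < N ψ by omega)
            have hm0 := eq_cstart_of_roleOf_head hq hm (Or.inr (by rw [← hjm]; exact hrole)) hw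
            subst hm0
            have h3 : ψ[q].length = 3 := by
              rcases hw q hq with h1 | h3
              · exfalso
                have := roleOf_cstart_add hq hm; rw [← hjm, hrole, h1] at this; simp at this
              · exact h3
            have hrole' := roleOf_cstart_add hq (m := r) (by omega)
            rw [show cstart ψ q + r = jj' + r - 1 by omega, h3] at hrole'
            simp only [show (3:ℕ) ≠ 1 by decide, ↓reduceIte] at hrole'
            rw [hrole']
            rcases (show r = 1 ∨ r = 2 by omega) with rfl | rfl <;> simp
      rcases hS with h | h | h
      · exact key 0 (by omega) (by rw [Nat.add_zero]; exact h)
      · exact key 1 (by omega) h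
      · exact key 2 (by omega) h
  · rintro ⟨p, hp, hp1, hp2, rfl⟩
    rcases hp with hp | hp
    · -- an own rail
      rw [mem_ownRails_iff] at hp
      obtain ⟨f, hf, ⟨r₁, r₂, hrs, hr⟩ | ⟨hc0, rfl, hrs | hrs⟩⟩ := hp
      · obtain ⟨hguard, hpl, hlt, -⟩ := place_absGad_xor hw ht hrs
        obtain ⟨-, hSeq, -⟩ := xorP_spec (ψ := ψ) (g := gadAt ψ i jj f) hguard
        refine ⟨_, hlt, ?_⟩
        rw [family_S, hpl]
        change _ ∈ (xorP _ _ _ _ _ hguard).S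
        rw [hSeq, Finset.mem_insert, Finset.mem_singleton]
        rcases hr with rfl | rfl
        · left; simp
        · right; simp
      · obtain ⟨hguard, hpl, hlt⟩ := place_absGad_or1 hw ht hrs
        obtain ⟨-, hSeq, -⟩ := or1P_spec (ψ := ψ) (g := gadAt ψ i jj f) hguard
        refine ⟨_, hlt, ?_⟩
        rw [family_S, hpl]
        change _ ∈ (or1P _ _ hguard).S
        rw [hSeq, Finset.mem_singleton, hc0]; rfl
      · obtain ⟨hguard, hpl, hlt, -⟩ := place_absGad_or3 hw ht hrs
        obtain ⟨-, hSeq, -⟩ := or3P_spec (ψ := ψ) (g := gadAt ψ i jj f) hguard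
        refine ⟨_, hlt, ?_⟩
        rw [family_S, hpl]
        change _ ∈ (or3P _ _ hguard).S
        rw [hSeq, Finset.mem_insert, hc0]; left; rfl
    · -- a neighbour's rail
      rw [extraRails_bspecAt hw ht hjj] at hp
      rcases hp with ⟨hi, ⟨rfl, hlt, rfl⟩ | ⟨rfl, hne, rfl⟩⟩ | ⟨hi, hc0, rfl, hrole⟩
      · -- the east neighbour's row chord
        have ht' : (i, jj + 1) ∈ tcoords ψ := (mem_tcoords_iff ψ).2 (Or.inr ⟨hi.le, by simp, by simpa using hlt⟩)
        have hrs : ∃ s, (bspecAt ψ i (jj + 1)).absGad 0 = some (.xor ((0, -1), 2, (3, 7)) s) := by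
          rw [bspecAt_tile hi (by omega)]
          simp only [BSpec.absGad, ↓reduceIte, show decide (2 ≤ jj + 1) = true by simp; omega]
          split_ifs <;> exact ⟨_, rfl⟩
        obtain ⟨s, hrs⟩ := hrs
        obtain ⟨hguard, hpl, hlt', -⟩ := place_absGad_xor hw ht' hrs
        obtain ⟨-, hSeq, -⟩ := xorP_spec (ψ := ψ) (g := gadAt ψ i ((jj + 1 : ℕ)) 0) hguard
        refine ⟨_, hlt', ?_⟩
        rw [family_S, hpl]
        change _ ∈ (xorP _ _ _ _ _ hguard).S
        rw [hSeq, Finset.mem_insert]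
        left
        simp only
        rw [cellAt_west (by omega)]
        simp
      · -- the chord of the tile below (a crossing, or the landing chord of the clause row)
        have hrow : rowOf ψ (varOf ψ (jj - 1)) ≤ i := by
          by_contra hlt
          apply hne
          have : tileTy ψ i (jj - 1) = .empty := (tileTy_eq_empty_iff ψ).2 (by omega)
          unfold tk3; rw [this]
        have ht' : (i + 1, jj) ∈ tcoords ψ := (mem_tcoords_iff ψ).2 (Or.inr ⟨by simp only; omega, hjj, hjN⟩)
        have hrs : ∃ f s, (bspecAt ψ (i + 1) jj).absGad f = some (.xor ((-1, 0), 1, BSpec.colOut (tk3 ψ i (jj - 1))) s) := by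
          rcases Nat.lt_or_ge (i + 1) (V ψ) with hi1 | hi1
          · rw [bspecAt_tile hi1 hjj]
            have hcross : tk3 ψ (i + 1) (jj - 1) = .c :=
              (tk3_eq_c_iff (ψ := ψ)).2 ((tileTy_eq_cross_iff ψ).2 (by omega))
            refine ⟨5, ((0, 0), 0, (13, 14)), ?_⟩
            simp only [BSpec.absGad, hcross, ↓reduceIte, show (5:ℕ) ≠ 0 by decide, show (5:ℕ) ≠ 1 by decide,
              show (5:ℕ) ≠ 2 by decide, show (5:ℕ) ≠ 3 by decide, show (5:ℕ) ≠ 4 by decide, Nat.add_sub_cancel,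
              show i + 1 ≠ 0 by omega]
          · have hiV' : i + 1 = V ψ := by omega
            rw [hiV', bspecAt_clause hjj]
            refine ⟨6, ((0, 0), 0, (if land3 ψ (jj - 1) then (9, 10) else (0, 4))), ?_⟩
            simp only [BSpec.absGad, ↓reduceIte]
            rw [show V ψ - 1 = i by omega]
        obtain ⟨f, s, hrs⟩ := hrs
        obtain ⟨hguard, hpl, hlt', -⟩ := place_absGad_xor hw ht' hrs
        obtain ⟨-, hSeq, -⟩ := xorP_spec (ψ := ψ) (g := gadAt ψ ((i + 1 : ℕ)) jj f) hguard
        refine ⟨_, hlt', ?_⟩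
        rw [family_S, hpl]
        change _ ∈ (xorP _ _ _ _ _ hguard).S
        rw [hSeq, Finset.mem_insert]
        left
        simp only
        rw [cellAt_up (by omega)]
        simp
      · -- the OR-gadget of the head of this terminal's clause
        subst hi
        obtain ⟨q, hq, m, hm, hjm⟩ := exists_cstart_add_of_lt (show jj - 1 < N ψ by omega)
        have hrole' := roleOf_cstart_add hq hm
        rw [← hjm] at hrole'
        have h3 : ψ[q].length = 3 := by
          rcases hw q hq with h1 | h3
          · rw [h1] at hrole'; simp at hrole'; rw [hrole'] at hrole; simp at hrole
          · exact h3
        rw [h3] at hrole'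
        simp only [show (3:ℕ) ≠ 1 by decide, ↓reduceIte] at hrole'
        have hm12 : m = 1 ∨ m = 2 := by
          rcases hrole with hr | hr <;> rw [hr] at hrole' <;> split_ifs at hrole' <;> omega
        -- the head tile
        have hcs : cstart ψ q + 2 < N ψ := cstart_add_lt ψ hq (by omega)
        have hth : (V ψ, cstart ψ q + 1) ∈ tcoords ψ := (mem_tcoords_iff ψ).2 (Or.inr ⟨le_rfl, by simp, by simp only; omega⟩)
        have hrs : (bspecAt ψ (V ψ) (cstart ψ q + 1)).absGad 7 = some .or3 := by
          rw [bspecAt_clause (by simp)]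
          simp only [BSpec.absGad, show (7:ℕ) ≠ 6 by decide, ↓reduceIte, Nat.add_sub_cancel]
          have hhead := roleOf_cstart_add hq (m := 0) (by omega)
          rw [Nat.add_zero, h3] at hhead
          simp only [show (3:ℕ) ≠ 1 by decide, ↓reduceIte] at hhead
          rw [hhead]
          simp [show cstart ψ q + 1 < N ψ by omega]
        obtain ⟨hguard, hpl, hlt', -⟩ := place_absGad_or3 hw hth hrs
        obtain ⟨-, hSeq, -⟩ := or3P_spec (ψ := ψ) (g := gadAt ψ (V ψ) ((cstart ψ q + 1 : ℕ)) 7) hguard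
        refine ⟨_, hlt', ?_⟩
        rw [family_S, hpl]
        change _ ∈ (or3P _ _ hguard).S
        rw [hSeq, Finset.mem_insert, Finset.mem_insert, Finset.mem_singleton, hc0]
        have hk : ∀ r : ℕ, cellAt ψ (V ψ) ((cstart ψ q + 1 : ℕ)) 0 + r = cellAt ψ (V ψ) ((cstart ψ q + 1 + r : ℕ)) 0 := by
          intro r
          rw [cellAt_nat, if_neg (by omega), if_neg (lt_irrefl _), cellAt_nat, if_neg (by omega), if_neg (lt_irrefl _)]
          unfold clauseBead; omega
        have hjjq : jj = cstart ψ q + 1 + m := by omega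
        subst hjjq
        rcases hm12 with rfl | rfl
        · right; left; rw [hk 1]; rfl
        · right; right; rw [hk 2]; rfl

end slots

/-! ### Cells and connectors of the picture are the cells and connectors of the chain -/

section cells

/-- **The cell kinds of every bundle are the cells of its recipe** (from `cells_match`): the data of
a cell kind present at a tile … [folklore] -/
theorem absCell_of_cellData {b : BSpec} (hb : b ∈ BSpec.all) {κ : Kind} (hκ : κ ∈ b.bundle) {ty : GridCell.CellTy} {c : ℕ}
    {U : List (Fin 16 × Fin 16)} (hcd : cellData κ = some (ty, c, U)) :
    c < 3 ∧ ∃ U', b.absCell c = some (ty, U') ∧ slotSetEqB U U' = true := by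
  have hc : c < 3 := by revert hcd; cases κ <;> simp [cellData] <;> rintro rfl rfl rfl <;> decide
  refine ⟨hc, ?_⟩
  have hm := cells_match b hb c hc
  have hmem : (ty, U) ∈ (b.bundle.filterMap fun κ => (cellData κ).bind fun d => if d.2.1 = c then some (d.1, d.2.2) else none) :=
    List.mem_filterMap.2 ⟨κ, hκ, by rw [hcd]; simp⟩
  revert hm
  generalize (b.bundle.filterMap fun κ => (cellData κ).bind fun d => if d.2.1 = c then some (d.1, d.2.2) else none) = L at hmem ⊢
  intro hm
  match L, b.absCell c, hm, hmem with
  | [(ty₁, U₁)], some (ty', U'), hm, hmem =>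
    simp only [List.mem_singleton, Prod.mk.injEq] at hmem
    obtain ⟨rfl, rfl⟩ := hmem
    simp only [Bool.and_eq_true, decide_eq_true_eq] at hm
    exact ⟨U', by rw [hm.1], hm.2⟩
  | [], none, _, hmem => simp at hmem
  | [], some _, hm, _ => simp at hm
  | [_], none, hm, _ => simp at hm
  | _ :: _ :: _, _, hm, _ => simp at hm

/-- … and every cell of the recipe is drawn by a cell kind of the bundle. [folklore] -/
theorem cellData_of_absCell {b : BSpec} (hb : b ∈ BSpec.all) {c : ℕ} (hc : c < 3) {ty : GridCell.CellTy} {U' : List (ℕ × ℕ)}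
    (h : b.absCell c = some (ty, U')) : ∃ κ ∈ b.bundle, ∃ U, cellData κ = some (ty, c, U) ∧ slotSetEqB U U' = true := by
  have hm := cells_match b hb c hc
  rw [h] at hm
  revert hm
  generalize hL : (b.bundle.filterMap fun κ => (cellData κ).bind fun d => if d.2.1 = c then some (d.1, d.2.2) else none) = L
  intro hm
  match L, hm with
  | [(ty₁, U₁)], hm =>
    simp only [Bool.and_eq_true, decide_eq_true_eq] at hm
    obtain ⟨rfl, hU⟩ := hm
    have hmem : (ty₁, U₁) ∈ (b.bundle.filterMap fun κ => (cellData κ).bind fun d => if d.2.1 = c then some (d.1, d.2.2) else none) := by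
      rw [hL]; simp
    obtain ⟨κ, hκ, hk⟩ := List.mem_filterMap.1 hmem
    cases hcd : cellData κ with
    | none => rw [hcd] at hk; simp at hk
    | some d =>
      obtain ⟨ty₂, c₂, U₂⟩ := d
      rw [hcd] at hk
      simp only [Option.bind_some] at hk
      split_ifs at hk with hcc
      simp only [Option.some.injEq, Prod.mk.injEq] at hk
      obtain ⟨rfl, rfl⟩ := hk
      subst hcc
      exact ⟨κ, hκ, U₂, hcd, hU⟩
  | [], hm => simp at hm
  | _ :: _ :: _, hm => simp at hm

/-- The cells of the recipe of a tile: all three positions in a tile row, position `0` in the clause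
row, position `2` for the doubling cell; with their types. [folklore] -/
theorem absCell_bspecAt {i jj : ℕ} (ht : (i, jj) ∈ tcoords ψ) (c : ℕ) :
    (bspecAt ψ i jj).absCell c =
      if i = 0 ∧ jj = 0 then (if c = 2 then some (.bead, []) else none)
      else if i < V ψ then
        (if c ≤ 2 then some (cellTyAt ψ (cellAt ψ i jj c), ((bspecAt ψ i jj).absCell c).elim [] Prod.snd) else none)
      else (if c = 0 then some (.bead, ((bspecAt ψ i jj).absCell c).elim [] Prod.snd) else none) := by
  rcases tile_classes ht with ⟨rfl, rfl, hb⟩ | ⟨hi, hj, hj', hb⟩ | ⟨rfl, hj, hj', hV, hb⟩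
  · rw [hb]; simp [BSpec.absCell]
  · rw [if_neg (by omega), if_pos hi]
    have hty : ∀ c, (hc : c < 3) → cellTyAt ψ (tileCell ψ i (jj - 1) c) =
        if tileTy ψ i (jj - 1) = .cross then (if c = 0 then .pc else if c = 1 then .pct else .pc) else .bead :=
      fun c hc => cellTyAt_tileCell ψ hi (show jj - 1 < N ψ by omega) hc
    have hk : ∀ c, cellAt ψ i jj c = tileCell ψ i (jj - 1) c := fun c => by rw [cellAt_nat, if_neg (by omega), if_pos hi]
    rcases Nat.lt_or_ge c 3 with hc3 | hc3
    · rw [if_pos (show c ≤ 2 by omega), hb]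
      by_cases hc : tk3 ψ i (jj - 1) = .c
      · have hcross := (tk3_eq_c_iff (ψ := ψ)).1 hc
        interval_cases c <;> simp [BSpec.absCell, hc, hk, hty 0 (by omega), hty 1 (by omega), hty 2 (by omega), hcross]
      · have hncross : tileTy ψ i (jj - 1) ≠ .cross := fun hh => hc ((tk3_eq_c_iff (ψ := ψ)).2 hh)
        interval_cases c <;> simp [BSpec.absCell, hc, hk, hty 0 (by omega), hty 1 (by omega), hty 2 (by omega), hncross]
    · rw [if_neg (show ¬ c ≤ 2 by omega), hb]
      have h0 : c ≠ 0 := by omega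
      have h1 : c ≠ 1 := by omega
      have h2 : c ≠ 2 := by omega
      by_cases hc : tk3 ψ i (jj - 1) = .c <;> simp [BSpec.absCell, hc, h0, h1, h2]
  · rw [if_neg (by omega), if_neg (lt_irrefl _), hb]
    simp only [BSpec.absCell]
    by_cases hc : c = 0 <;> simp [hc]

/-- Every cell of the chain is a cell of a tile of the picture. [folklore] -/
theorem exists_tile_of_lt_ncells (hN : 0 < N ψ) {k : ℕ} (hk : k < ncells ψ) :
    ∃ i jj c, (i, jj) ∈ tcoords ψ ∧ cellAt ψ i jj c = k ∧ ((bspecAt ψ i jj).absCell c).isSome := by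
  have hV : 0 < V ψ := V_pos_of_N_pos ψ hN
  rcases Nat.eq_zero_or_pos k with rfl | hk0
  · refine ⟨0, 0, 2, (mem_tcoords_iff ψ).2 (Or.inl rfl), by simp [cellAt], ?_⟩
    rw [bspecAt_zero_zero]; decide
  rcases Nat.lt_or_ge k (1 + 3 * (V ψ * N ψ)) with hk1 | hk1
  · -- a tile cell
    have ht : (k - 1) / 3 < V ψ * N ψ := by omega
    have hi : (k - 1) / 3 / N ψ < V ψ := (Nat.div_lt_iff_lt_mul hN).2 ht
    have hj : (k - 1) / 3 % N ψ < N ψ := Nat.mod_lt _ hN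
    have htij : (k - 1) / 3 = (k - 1) / 3 / N ψ * N ψ + (k - 1) / 3 % N ψ := by
      have := Nat.div_add_mod ((k - 1) / 3) (N ψ); rw [Nat.mul_comm] at this; omega
    have hkeq : k = tileCell ψ ((k - 1) / 3 / N ψ) ((k - 1) / 3 % N ψ) ((k - 1) % 3) := by
      unfold tileCell; rw [← htij]; omega
    have htc : ((k - 1) / 3 / N ψ, (k - 1) / 3 % N ψ + 1) ∈ tcoords ψ :=
      (mem_tcoords_iff ψ).2 (Or.inr ⟨hi.le, by simp, by simpa using hj⟩)
    refine ⟨(k - 1) / 3 / N ψ, (k - 1) / 3 % N ψ + 1, (k - 1) % 3, htc, ?_, ?_⟩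
    · rw [cellAt_nat, if_neg (by omega), if_pos hi, Nat.add_sub_cancel]; exact hkeq.symm
    · rw [absCell_bspecAt htc, if_neg (by simp), if_pos hi, if_pos (by omega)]; rfl
  · -- a clause-row terminal
    have hj : k - (1 + 3 * (V ψ * N ψ)) < N ψ := by unfold ncells at hk; omega
    have htc : (V ψ, k - (1 + 3 * (V ψ * N ψ)) + 1) ∈ tcoords ψ :=
      (mem_tcoords_iff ψ).2 (Or.inr ⟨le_rfl, by simp, by simpa using hj⟩)
    refine ⟨V ψ, k - (1 + 3 * (V ψ * N ψ)) + 1, 0, htc, ?_, ?_⟩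
    · rw [cellAt_nat, if_neg (by omega), if_neg (lt_irrefl _)]; unfold clauseBead; simp only [Nat.add_sub_cancel]; omega
    · rw [absCell_bspecAt htc, if_neg (by simp only [not_and]; omega), if_neg (lt_irrefl _), if_pos rfl]; rfl

variable (hw : WidthOK ψ) (hN : 0 < N ψ)
include hw hN

/-- **The slotted edges of a cell kind are the slots in its cell** (unordered). [folklore] -/
theorem cell_slots {κ : Kind} {i jj : ℕ} (ho : ((κ, i, jj) : Obj) ∈ objs ψ) {ty : GridCell.CellTy} {c : ℕ}
    {U : List (Fin 16 × Fin 16)} (hcd : cellData κ = some (ty, c, U)) (x y : Fin 16) :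
    ((x, y) ∈ U ∨ (y, x) ∈ U) ↔ ∃ g < ngadgets ψ, gs (cellAt ψ i jj c) (x, y) ∈ (family ψ).S g ∨ gs (cellAt ψ i jj c) (y, x) ∈ (family ψ).S g := by
  obtain ⟨ht, hκ⟩ := (mem_objs_iff ψ).1 ho
  simp only at ht hκ
  obtain ⟨hc3, U', hcell, hUU⟩ := absCell_of_cellData (BSpec.mem_all _) hκ hcd
  have hss := slots_spec (bspecAt ψ i jj) (BSpec.mem_all _) c hc3
  rw [hcell] at hss
  simp only at hss
  -- the doubling cell has no slots
  by_cases hjj : jj = 0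
  · have hi : i = 0 := by have := (mem_tcoords_iff ψ).1 ht; simp only [Prod.mk.injEq] at this; omega
    subst hjj; subst hi
    rw [bspecAt_zero_zero] at hcell hκ
    simp only [BSpec.absCell] at hcell
    split_ifs at hcell with h2
    simp only [Option.some.injEq, Prod.mk.injEq] at hcell
    obtain ⟨-, rfl⟩ := hcell
    have hUU' : ∀ a b : Fin 16, (a, b) ∉ U := by simpa [slotSetEqB] using hUU
    have hU : U = [] := List.eq_nil_iff_forall_not_mem.2 fun e => hUU' e.1 e.2
    subst hU
    simp only [List.not_mem_nil, or_self, false_iff, not_exists, not_and, not_or]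
    intro g hg
    -- a slot in cell `0`: its gadget's rails are in genuine tiles
    have key : ∀ e, gs (cellAt ψ 0 0 c) e ∉ (family ψ).S g := by
      intro e hS
      obtain ⟨k, e₀, hgs, -, -, -, -⟩ := mem_S_spec ψ hS
      have hk : cellAt ψ 0 0 c = k := ((gs_inj).1 hgs).1
      have h0 : cellAt ψ ((0 : ℕ) : ℤ) ((0 : ℕ) : ℤ) c = 0 := by simp [cellAt]
      rw [show ((0 : ℕ) : ℤ) = 0 from rfl] at h0
      rw [h0] at hk
      subst hk
      -- but every slot is a rail of the recipe at a genuine tile, a positive cell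
      have hplace : ∃ P, place ψ g = some P := by
        rw [family_S] at hS; cases hP : place ψ g with
        | none => rw [hP] at hS; simp at hS
        | some P => exact ⟨P, rfl⟩
      obtain ⟨P, hP⟩ := hplace
      have hspec : ∃ spec, gad ψ g = some spec := by
        unfold place at hP; cases hs : gad ψ g with
        | none => rw [hs] at hP; simp at hP
        | some spec => exact ⟨spec, rfl⟩
      obtain ⟨spec, hs⟩ := hspec
      obtain ⟨i', jj', f, rs, ht', hg', hrs, -⟩ := absGad_of_gad hw hN hg hs
      rw [← hg'] at hS
      have hpos : ∀ {i₁ jj₁ c₁ : ℕ}, (i₁, jj₁) ∈ tcoords ψ → 1 ≤ jj₁ → 0 < cellAt ψ i₁ jj₁ c₁ := by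
        intro i₁ jj₁ c₁ h1 h2
        rw [cellAt_nat, if_neg (by omega)]
        split_ifs <;> [unfold tileCell; unfold clauseBead] <;> omega
      rcases rs with ⟨r₁, r₂⟩ | _ | _
      · obtain ⟨hguard, hpl, -⟩ := place_absGad_xor hw ht' hrs
        obtain ⟨-, hSeq, -⟩ := xorP_spec (ψ := ψ) (g := gadAt ψ i' jj' f) hguard
        rw [family_S, hpl] at hS
        change _ ∈ (xorP _ _ _ _ _ hguard).S at hS
        rw [hSeq, Finset.mem_insert, Finset.mem_singleton] at hS
        obtain ⟨i₁, jj₁, ⟨hi₁, hjj₁⟩, ht₁, hjj₁', hjj'⟩ := rail_tile_mem ht' hrs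
        have hok := absGad_ok (bspecAt ψ i' jj') (BSpec.mem_all _) f (f_lt_of_absGad hrs)
        rw [hrs] at hok
        simp only [Bool.and_eq_true, decide_eq_true_eq] at hok
        obtain ⟨⟨-, -, -, -, -, -, -, -, -, hr₂⟩, -⟩ := hok
        rcases hS with h | h <;> have hk := ((gs_inj).1 h).1
        · rw [hi₁, hjj₁] at hk
          have := hpos (c₁ := r₁.2.1) ht₁ hjj₁'
          omega
        · rw [hr₂, cellAt_here] at hk
          have := hpos (c₁ := r₂.2.1) ht' hjj'
          omega
      · have hjj' : 1 ≤ jj' := by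
          have := (mem_tcoords_iff ψ).1 ht'; simp only [Prod.mk.injEq] at this
          rcases this with ⟨h0, h0'⟩ | ⟨-, h1, -⟩
          · exfalso; subst h0; subst h0'; rw [bspecAt_zero_zero] at hrs; simp [BSpec.absGad] at hrs
          · exact h1
        obtain ⟨hguard, hpl, -⟩ := place_absGad_or1 hw ht' hrs
        obtain ⟨-, hSeq, -⟩ := or1P_spec (ψ := ψ) (g := gadAt ψ i' jj' f) hguard
        rw [family_S, hpl] at hS
        change _ ∈ (or1P _ _ hguard).S at hS
        rw [hSeq, Finset.mem_singleton] at hS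
        have hk := ((gs_inj).1 hS).1
        have := hpos (c₁ := 0) ht' hjj'
        omega
      · obtain ⟨hguard, hpl, -, hi', -⟩ := place_absGad_or3 hw ht' hrs
        have hjj' : 1 ≤ jj' := by
          have := (mem_tcoords_iff ψ).1 ht'; simp only [Prod.mk.injEq] at this
          have := V_pos_of_N_pos ψ hN; omega
        obtain ⟨-, hSeq, -⟩ := or3P_spec (ψ := ψ) (g := gadAt ψ i' jj' f) hguard
        rw [family_S, hpl] at hS
        change _ ∈ (or3P _ _ hguard).S at hS
        rw [hSeq, Finset.mem_insert, Finset.mem_insert, Finset.mem_singleton] at hS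
        have := hpos (c₁ := 0) ht' hjj'
        rcases hS with h | h | h <;> have hk := ((gs_inj).1 h).1 <;> omega
    exact ⟨key _, key _⟩
  · have hjj1 : 1 ≤ jj := by omega
    have hcl : i = V ψ → c = 0 := by
      intro hi
      rw [absCell_bspecAt ht, if_neg (by simp only [not_and]; omega), hi, if_neg (lt_irrefl _)] at hcell
      split_ifs at hcell with h0; exact h0
    have hc : c ≤ 2 := by omega
    -- `U` (kind) ≃ `U'` (recipe) ≃ own ++ extra rails ≃ slots
    have step1 : ((x, y) ∈ U ∨ (y, x) ∈ U) ↔ ((x.val, y.val) ∈ U' ∨ (y.val, x.val) ∈ U') := by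
      simp only [slotSetEqB, Bool.and_eq_true, List.all_eq_true, Bool.or_eq_true, List.contains_iff_mem,
        List.any_eq_true, beq_iff_eq] at hUU
      obtain ⟨h1, h2⟩ := hUU
      constructor
      · rintro (h | h)
        · exact h1 _ h
        · exact (h1 _ h).symm
      · rintro (h | h)
        · obtain ⟨e', he', h'⟩ := h2 _ h
          rcases h' with h' | h' <;> simp only [Prod.mk.injEq] at h'
          · have : e' = (x, y) := Prod.ext (Fin.ext h'.1) (Fin.ext h'.2)
            subst this; exact Or.inl he'
          · have : e' = (y, x) := Prod.ext (Fin.ext h'.2) (Fin.ext h'.1)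
            subst this; exact Or.inr he'
        · obtain ⟨e', he', h'⟩ := h2 _ h
          rcases h' with h' | h' <;> simp only [Prod.mk.injEq] at h'
          · have : e' = (y, x) := Prod.ext (Fin.ext h'.1) (Fin.ext h'.2)
            subst this; exact Or.inr he'
          · have : e' = (x, y) := Prod.ext (Fin.ext h'.2) (Fin.ext h'.1)
            subst this; exact Or.inl he'
    have step2 : ((x.val, y.val) ∈ U' ∨ (y.val, x.val) ∈ U') ↔
        ((x.val, y.val) ∈ (bspecAt ψ i jj).ownRails c ++ (bspecAt ψ i jj).extraRails c ∨
          (y.val, x.val) ∈ (bspecAt ψ i jj).ownRails c ++ (bspecAt ψ i jj).extraRails c) := by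
      simp only [slotSetEqNB, Bool.and_eq_true, List.all_eq_true, Bool.or_eq_true, List.contains_iff_mem] at hss
      obtain ⟨h1, h2⟩ := hss
      constructor
      · rintro (h | h)
        · exact h1 _ h
        · exact (h1 _ h).symm
      · rintro (h | h)
        · exact h2 _ h
        · exact (h2 _ h).symm
    rw [step1, step2]
    have hfin : ∀ a b : Fin 16, finPair (a.val, b.val) = (a, b) := fun a b => by
      simp [finPair, Fin.ofNat, Nat.mod_eq_of_lt a.isLt, Nat.mod_eq_of_lt b.isLt]
    constructor
    · rintro (h | h)
      · obtain ⟨g, hg, hS⟩ := (isSlot_iff hw hN ht hjj1 hc hcl (x, y)).2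
          ⟨(x.val, y.val), List.mem_append.1 h, x.isLt, y.isLt, (hfin x y).symm⟩
        exact ⟨g, hg, Or.inl hS⟩
      · obtain ⟨g, hg, hS⟩ := (isSlot_iff hw hN ht hjj1 hc hcl (y, x)).2
          ⟨(y.val, x.val), List.mem_append.1 h, y.isLt, x.isLt, (hfin y x).symm⟩
        exact ⟨g, hg, Or.inr hS⟩
    · rintro ⟨g, hg, hS | hS⟩
      · obtain ⟨p, hp, hp1, hp2, he⟩ := (isSlot_iff hw hN ht hjj1 hc hcl (x, y)).1 ⟨g, hg, hS⟩
        have : p = (x.val, y.val) := by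
          have h1 := congrArg (fun q : Fin 16 × Fin 16 => (q.1.val, q.2.val)) he
          simp only [finPair, Fin.ofNat] at h1
          obtain ⟨p1, p2⟩ := p
          simp only [Prod.mk.injEq] at h1 hp1 hp2 ⊢
          constructor <;> omega
        subst this
        exact Or.inl (List.mem_append.2 hp)
      · obtain ⟨p, hp, hp1, hp2, he⟩ := (isSlot_iff hw hN ht hjj1 hc hcl (y, x)).1 ⟨g, hg, hS⟩
        have : p = (y.val, x.val) := by
          have h1 := congrArg (fun q : Fin 16 × Fin 16 => (q.1.val, q.2.val)) he
          simp only [finPair, Fin.ofNat] at h1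
          obtain ⟨p1, p2⟩ := p
          simp only [Prod.mk.injEq] at h1 hp1 hp2 ⊢
          constructor <;> omega
        subst this
        exact Or.inr (List.mem_append.2 hp)

omit hw in
/-- **The type of the cell of a cell kind.** [folklore] -/
theorem cell_type {κ : Kind} {i jj : ℕ} (ho : ((κ, i, jj) : Obj) ∈ objs ψ) {ty : GridCell.CellTy} {c : ℕ}
    {U : List (Fin 16 × Fin 16)} (hcd : cellData κ = some (ty, c, U)) :
    cellTyAt ψ (cellAt ψ i jj c) = ty ∧ cellAt ψ i jj c < ncells ψ := by
  obtain ⟨ht, hκ⟩ := (mem_objs_iff ψ).1 ho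
  simp only at ht hκ
  obtain ⟨hc3, U', hcell, -⟩ := absCell_of_cellData (BSpec.mem_all _) hκ hcd
  rw [absCell_bspecAt ht] at hcell
  split_ifs at hcell with h0 h2 hi hc hc0
  · obtain ⟨rfl, rfl⟩ := h0
    simp only [Option.some.injEq, Prod.mk.injEq] at hcell
    obtain ⟨rfl, -⟩ := hcell
    subst h2
    refine ⟨by simp [cellAt, cellTyAt_zero], ?_⟩
    simp only [cellAt]; unfold ncells; simp
  · simp only [Option.some.injEq, Prod.mk.injEq] at hcell
    exact ⟨hcell.1, cellAt_lt_ncells ht hc⟩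
  · simp only [Option.some.injEq, Prod.mk.injEq] at hcell
    obtain ⟨rfl, -⟩ := hcell
    subst hc0
    have hV : 0 < V ψ := V_pos_of_N_pos ψ hN
    have htc := (mem_tcoords_iff ψ).1 ht
    simp only [Prod.mk.injEq] at htc
    have hiV : i = V ψ := by omega
    subst hiV
    refine ⟨?_, cellAt_lt_ncells ht (by omega)⟩
    rw [cellAt_nat, if_neg (by omega), if_neg (lt_irrefl _)]
    exact cellTyAt_clauseBead ψ _

end cells

section connectors

/-- The slotted edges of the cell kinds are listed cell edges. [folklore] -/
theorem cellData_U_ok (κ : Kind) :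
    (match cellData κ with
      | some (ty, _, U) => U.all fun u => ty.edgeList.contains u
      | none => true) = true := by
  cases κ <;> decide

/-- Cell edges are listed as increasing pairs. [folklore] -/
theorem edgeList_lt (ty : GridCell.CellTy) : (ty.edgeList.all fun e => decide (e.1 < e.2)) = true := by
  cases ty <;> decide

/-- **The connector kinds of every bundle are the connector edges of its recipe.** [folklore] -/
theorem absConns_of_connData {b : BSpec} (hb : b ∈ BSpec.all) {κ : Kind} (hκ : κ ∈ b.bundle) {d : ℕ × GridCell.CellTy × ℤ × ℕ}
    (hcd : connData κ = some d) : d ∈ b.absConns := by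
  rw [← conns_match b hb]
  exact List.mem_filterMap.2 ⟨κ, hκ, hcd⟩

/-- … and conversely. [folklore] -/
theorem connData_of_absConns {b : BSpec} (hb : b ∈ BSpec.all) {d : ℕ × GridCell.CellTy × ℤ × ℕ} (hd : d ∈ b.absConns) :
    ∃ κ ∈ b.bundle, connData κ = some d := by
  rw [← conns_match b hb] at hd
  exact List.mem_filterMap.1 hd

/-- **The connector edges of the recipe of a tile of the picture**: they join the exit corner of a
cell to the connector of the NEXT cell of the chain. [folklore] -/
theorem absConns_bspecAt (hN : 0 < N ψ) {i jj : ℕ} (ht : (i, jj) ∈ tcoords ψ) {d : ℕ × GridCell.CellTy × ℤ × ℕ}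
    (hd : d ∈ (bspecAt ψ i jj).absConns) :
    d.2.1 = cellTyAt ψ (cellAt ψ i jj d.1) ∧ cellAt ψ i ((jj : ℤ) + d.2.2.1) d.2.2.2 = cellAt ψ i jj d.1 + 1 ∧
      cellAt ψ i jj d.1 + 1 < ncells ψ ∧ ((bspecAt ψ i jj).absCell d.1).isSome := by
  have hV : 0 < V ψ := V_pos_of_N_pos ψ hN
  rcases tile_classes ht with ⟨rfl, rfl, hb⟩ | ⟨hi, hj, hj', hb⟩ | ⟨rfl, hj, hj', -, hb⟩
  · rw [hb] at hd ⊢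
    simp only [BSpec.absConns, List.mem_singleton] at hd
    subst hd
    simp only
    refine ⟨by simp [cellAt, cellTyAt_zero], ?_, ?_, by decide⟩
    · rw [show ((0 : ℕ) : ℤ) + 1 = ((1 : ℕ) : ℤ) by simp, cellAt_nat, if_neg one_ne_zero, if_pos hV]
      simp [cellAt, tileCell]
    · simp [cellAt]; unfold ncells; omega
  · have hk : ∀ c, cellAt ψ i jj c = tileCell ψ i (jj - 1) c := fun c => by rw [cellAt_nat, if_neg (by omega), if_pos hi]
    have hty := cellTyAt_tileCell_cases ψ hi (show jj - 1 < N ψ by omega)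
    rw [hb] at hd
    simp only [BSpec.absConns, List.mem_append] at hd
    have hcell : ∀ c, c ≤ 2 → ((bspecAt ψ i jj).absCell c).isSome := fun c hc => by
      rw [absCell_bspecAt ht, if_neg (by simp only [not_and]; omega), if_pos hi, if_pos hc]; rfl
    rcases hd with hd | hd
    · -- inner connectors
      have h01 : d = (0, cellTyAt ψ (cellAt ψ i jj 0), 0, 1) ∨ d = (1, cellTyAt ψ (cellAt ψ i jj 1), 0, 2) := by
        by_cases hc : tk3 ψ i (jj - 1) = .c
        · rw [if_pos hc] at hd
          have hcross := (tk3_eq_c_iff (ψ := ψ)).1 hc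
          simp only [List.mem_cons, List.not_mem_nil, or_false] at hd
          rw [hk, hk, (hty.1 hcross).1, (hty.1 hcross).2.1]
          exact hd
        · rw [if_neg hc] at hd
          have hncross : tileTy ψ i (jj - 1) ≠ .cross := fun hh => hc ((tk3_eq_c_iff (ψ := ψ)).2 hh)
          simp only [List.mem_cons, List.not_mem_nil, or_false] at hd
          rw [hk, hk, hty.2 hncross 0 (by omega), hty.2 hncross 1 (by omega)]
          exact hd
      rcases h01 with rfl | rfl
      · refine ⟨rfl, ?_, ?_, hcell 0 (by omega)⟩
        · simp only; rw [show (jj : ℤ) + 0 = jj by simp, hk, hk]; unfold tileCell; omega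
        · simp only; rw [hk]; have := tileCell_lt_ncells ψ hi (show jj - 1 < N ψ by omega) (c := 1) (by omega)
          unfold tileCell at this ⊢; omega
      · refine ⟨rfl, ?_, ?_, hcell 1 (by omega)⟩
        · simp only; rw [show (jj : ℤ) + 0 = jj by simp, hk, hk]; unfold tileCell; omega
        · simp only; rw [hk]; have := tileCell_lt_ncells ψ hi (show jj - 1 < N ψ by omega) (c := 2) (by omega)
          unfold tileCell at this ⊢; omega
    · -- the connector to the next tile
      by_cases he : jj < N ψ
      · rw [if_pos (by simpa using he)] at hd
        simp only [List.mem_singleton] at hd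
        subst hd
        have hty2 : (if tk3 ψ i (jj - 1) = TK3.c then GridCell.CellTy.pc else .bead) = cellTyAt ψ (cellAt ψ i jj 2) := by
          rw [hk]
          by_cases hc : tk3 ψ i (jj - 1) = .c
          · rw [if_pos hc, (hty.1 ((tk3_eq_c_iff (ψ := ψ)).1 hc)).2.2]
          · rw [if_neg hc, hty.2 (fun hh => hc ((tk3_eq_c_iff (ψ := ψ)).2 hh)) 2 (by omega)]
        refine ⟨hty2, ?_, ?_, hcell 2 le_rfl⟩
        · simp only
          rw [show (jj : ℤ) + 1 = ((jj + 1 : ℕ) : ℤ) by push_cast; ring, cellAt_nat, if_neg (by omega), if_pos hi, hk]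
          unfold tileCell; rw [Nat.add_sub_cancel]; omega
        · simp only; rw [hk]
          have := tileCell_lt_ncells ψ hi he (c := 0) (by omega)
          unfold tileCell at this ⊢; omega
      · rw [if_neg (by simpa using he)] at hd
        simp at hd
  · rw [hb] at hd
    simp only [BSpec.absConns] at hd
    split_ifs at hd with he
    · simp only [List.mem_singleton] at hd
      subst hd
      simp only [decide_eq_true_eq] at he
      have hk0 : cellAt ψ (V ψ) jj 0 = clauseBead ψ (jj - 1) := by rw [cellAt_nat, if_neg (by omega), if_neg (lt_irrefl _)]
      refine ⟨by rw [hk0, cellTyAt_clauseBead], ?_, ?_, ?_⟩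
      · simp only
        rw [show (jj : ℤ) + 1 = ((jj + 1 : ℕ) : ℤ) by push_cast; ring, cellAt_nat, if_neg (by omega), if_neg (lt_irrefl _), hk0]
        unfold clauseBead; omega
      · simp only; rw [hk0]; have := clauseBead_lt_ncells ψ he; unfold clauseBead at this ⊢; omega
      · rw [absCell_bspecAt ht, if_neg (by simp only [not_and]; omega), if_neg (lt_irrefl _), if_pos rfl]; rfl
    · simp at hd

/-- **Coverage of the connector edges of the chain**: for every cell but the last, the edge from its
exit corner to the next connector is drawn — by a connector kind, or by a return path. [folklore] -/
theorem conn_edge_drawn (hN : 0 < N ψ) {k : ℕ} (hk : k + 1 < ncells ψ) :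
    (∃ o ∈ objs ψ, ∃ d, connData o.1 = some d ∧ cellAt ψ o.2.1 o.2.2 d.1 = k ∧ d.2.1 = cellTyAt ψ k ∧
        cellAt ψ o.2.1 ((o.2.2 : ℤ) + d.2.2.1) d.2.2.2 = k + 1) ∨
    (∃ i < V ψ, retStart ψ i = vtx k (cellTyAt ψ k).qIdx ∧ retEnd ψ i = conn (k + 1)) := by
  have hV : 0 < V ψ := V_pos_of_N_pos ψ hN
  obtain ⟨i, jj, c, ht, hkc, hsome⟩ := exists_tile_of_lt_ncells hN (show k < ncells ψ by omega)
  -- which connector of the recipe?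
  have key : ∀ d ∈ (bspecAt ψ i jj).absConns, d.1 = c →
      (∃ o ∈ objs ψ, ∃ d, connData o.1 = some d ∧ cellAt ψ o.2.1 o.2.2 d.1 = k ∧ d.2.1 = cellTyAt ψ k ∧
        cellAt ψ o.2.1 ((o.2.2 : ℤ) + d.2.2.1) d.2.2.2 = k + 1) := by
    intro d hd hdc
    obtain ⟨κ, hκ, hcd⟩ := connData_of_absConns (BSpec.mem_all _) hd
    obtain ⟨hty, hnext, -, -⟩ := absConns_bspecAt hN ht hd
    refine ⟨(κ, i, jj), (mem_objs_iff ψ).2 ⟨ht, hκ⟩, d, hcd, ?_, ?_, ?_⟩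
    · simp only; rw [hdc, hkc]
    · rw [hty, hdc, hkc]
    · simp only; rw [hnext, hdc, hkc]
  rcases tile_classes ht with ⟨rfl, rfl, hb⟩ | ⟨hi, hj, hj', hb⟩ | ⟨rfl, hj, hj', -, hb⟩
  · -- the doubling cell
    have hc : c = 2 := by
      rw [hb] at hsome; simp only [BSpec.absCell] at hsome
      split_ifs at hsome with h2
      · exact h2
      · simp at hsome
    left
    exact key (2, .bead, 1, 0) (by rw [hb]; simp [BSpec.absConns]) hc.symm
  · have hc : c ≤ 2 := by
      rw [absCell_bspecAt ht, if_neg (by simp only [not_and]; omega), if_pos hi] at hsome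
      split_ifs at hsome with h; exact h; simp at hsome
    rcases Nat.lt_or_ge c 2 with hc2 | hc2
    · -- an inner connector
      left
      interval_cases c
      · refine key (0, (if tk3 ψ i (jj - 1) = .c then .pc else .bead), 0, 1) ?_ rfl
        rw [hb]; simp only [BSpec.absConns, List.mem_append]; left; split_ifs <;> simp
      · refine key (1, (if tk3 ψ i (jj - 1) = .c then .pct else .bead), 0, 2) ?_ rfl
        rw [hb]; simp only [BSpec.absConns, List.mem_append]; left; split_ifs <;> simp
    · have hc : c = 2 := by omega
      subst hc
      rcases Nat.lt_or_ge jj (N ψ) with hjN | hjN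
      · -- the connector to the next tile
        left
        refine key (2, (if tk3 ψ i (jj - 1) = .c then .pc else .bead), 1, 0) ?_ rfl
        rw [hb]; simp only [BSpec.absConns, List.mem_append]; right; rw [if_pos (by simpa using hjN)]; simp
      · -- the return path of the row
        right
        have hjj : jj = N ψ := by omega
        subst hjj
        have hkc' : k = tileCell ψ i (N ψ - 1) 2 := by rw [← hkc, cellAt_nat, if_neg (by omega), if_pos hi]
        refine ⟨i, hi, ?_, ?_⟩
        · rw [hkc']
          have hq : (cellTyAt ψ (tileCell ψ i (N ψ - 1) 2)).qIdx = 3 := by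
            have hty := cellTyAt_tileCell_cases ψ hi (show N ψ - 1 < N ψ by omega)
            by_cases hcr : tileTy ψ i (N ψ - 1) = .cross
            · rw [(hty.1 hcr).2.2]; rfl
            · rw [hty.2 hcr 2 (by omega)]; rfl
          rw [hq]; simp [retStart, GridCell.vtx]
        · rw [hkc']; simp [retEnd, GridCell.conn]
  · -- a clause-row terminal
    have hc : c = 0 := by
      rw [absCell_bspecAt ht, if_neg (by simp only [not_and]; omega), if_neg (lt_irrefl _)] at hsome
      split_ifs at hsome with h; exact h; simp at hsome
    subst hc
    have hjN : jj < N ψ := by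
      rw [← hkc, cellAt_nat, if_neg (by omega), if_neg (lt_irrefl _)] at hk
      unfold clauseBead ncells at hk; omega
    left
    refine key (0, .bead, 1, 0) ?_ rfl
    rw [hb]; simp only [BSpec.absConns]; rw [if_pos (by simpa using hjN)]; simp

end connectors

/-! ## The drawing draws `graphOf ψ`

With the explicit edge list `GridFormulaFP.edgesOf ψ` of `graphOf ψ`
(`GridSAWGridFormulaGraphExplicit.lean`: the chain edges that are not slots, and the edges of the
placed gadgets), adjacency in `graphOf ψ` is the existence of a drawn edge with the two names as
ends. -/

section draws

open GridFormulaFP in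
/-- An unordered pair of names. [folklore] -/
def SymEq (p : ℕ × ℕ) (a b : ℕ) : Prop := (p.1 = a ∧ p.2 = b) ∨ (p.1 = b ∧ p.2 = a)

/-- `SymEq` is invariant under swapping the pair. [folklore] -/
theorem SymEq.swap {p : ℕ × ℕ} {a b : ℕ} (h : SymEq p a b) : SymEq p.swap a b := by
  rcases h with ⟨h1, h2⟩ | ⟨h1, h2⟩
  · exact Or.inr ⟨h2, h1⟩
  · exact Or.inl ⟨h2, h1⟩

/-- `SymEq` is symmetric in the two names. [folklore] -/
theorem SymEq.comm {p : ℕ × ℕ} {a b : ℕ} (h : SymEq p a b) : SymEq p b a := by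
  rcases h with ⟨h1, h2⟩ | ⟨h1, h2⟩
  · exact Or.inr ⟨h1, h2⟩
  · exact Or.inl ⟨h1, h2⟩

/-- **The drawn edges, by objects**: a drawn edge joins the names of an abstract edge of an object,
or is a return path. [folklore] -/
theorem draws_iff {a b : ℕ} :
    (∃ d ∈ (drawing ψ).edges, (d.1 = a ∧ d.2.1 = b) ∨ (d.1 = b ∧ d.2.1 = a)) ↔
      (∃ o ∈ objs ψ, ∃ q ∈ absEdges o.1, SymEq (oname ψ o q.1, oname ψ o q.2) a b) ∨
        ∃ i < V ψ, SymEq (retStart ψ i, retEnd ψ i) a b := by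
  constructor
  · rintro ⟨d, hd, hab⟩
    rcases mem_dedges_iff.1 hd with ⟨o, ho, e, he, rfl⟩ | ⟨i, hi, rfl⟩
    · left
      have hok := absEdges_ok o.1
      simp only [edgeSetEqB, Bool.and_eq_true, List.all_eq_true, Bool.or_eq_true, List.contains_iff_mem] at hok
      obtain ⟨h1, -⟩ := hok
      rcases h1 _ (List.mem_map.2 ⟨e, he, rfl⟩) with h | h
      · exact ⟨o, ho, _, h, hab⟩
      · refine ⟨o, ho, _, h, ?_⟩
        change SymEq (oname ψ o e.2.1, oname ψ o e.1) a b
        rcases hab with ⟨h1, h2⟩ | ⟨h1, h2⟩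
        · exact Or.inr ⟨h2, h1⟩
        · exact Or.inl ⟨h2, h1⟩
    · exact Or.inr ⟨i, hi, hab⟩
  · rintro (⟨o, ho, q, hq, hab⟩ | ⟨i, hi, hab⟩)
    · have hok := absEdges_ok o.1
      simp only [edgeSetEqB, Bool.and_eq_true, List.all_eq_true, Bool.or_eq_true, List.contains_iff_mem] at hok
      obtain ⟨-, h2⟩ := hok
      rcases h2 _ hq with h | h <;> obtain ⟨e, he, hqe⟩ := List.mem_map.1 h
      · refine ⟨_, mem_dedges_iff.2 (Or.inl ⟨o, ho, e, he, rfl⟩), ?_⟩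
        obtain ⟨q1, q2⟩ := q
        simp only [Prod.mk.injEq] at hqe
        change SymEq (oname ψ o e.1, oname ψ o e.2.1) a b
        rw [hqe.1, hqe.2]; exact hab
      · refine ⟨_, mem_dedges_iff.2 (Or.inl ⟨o, ho, e, he, rfl⟩), ?_⟩
        obtain ⟨q1, q2⟩ := q
        simp only [Prod.swap, Prod.mk.injEq] at hqe
        simp only
        rw [hqe.1, hqe.2]
        rcases hab with ⟨h1, h2⟩ | ⟨h1, h2⟩
        · exact Or.inr ⟨h2, h1⟩
        · exact Or.inl ⟨h2, h1⟩
    · exact ⟨_, mem_dedges_iff.2 (Or.inr ⟨i, hi, rfl⟩), hab⟩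

/-- The kind of an object: its data, in one of the three classes. [folklore] -/
theorem kind_cases (κ : Kind) : (∃ cd, chordData κ = some cd) ∨ (∃ d, chordData κ = none ∧ cellData κ = some d) ∨
    (∃ d, chordData κ = none ∧ cellData κ = none ∧ connData κ = some d) := by
  have := kind_classified κ
  cases h1 : chordData κ with
  | some cd => exact Or.inl ⟨cd, rfl⟩
  | none =>
    cases h2 : cellData κ with
    | some d => exact Or.inr (Or.inl ⟨d, rfl, rfl⟩)
    | none =>
      cases h3 : connData κ with
      | some d => exact Or.inr (Or.inr ⟨d, rfl, rfl, rfl⟩)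
      | none => rw [h1, h2, h3] at this; simp at this

/-- Slots are edges between block vertices. [folklore] -/
theorem not_mem_slotsOf_conn (k v : ℕ) : (conn k, v) ∉ GridFormulaFP.slotsOf ψ ∧ (v, conn k) ∉ GridFormulaFP.slotsOf ψ := by
  constructor <;> intro h <;> obtain ⟨g, -, hS⟩ := (GridFormulaFP.mem_slotsOf_iff ψ).1 h <;>
    obtain ⟨k', e₀, he, -⟩ := mem_S_spec ψ hS <;> simp only [gs, Prod.mk.injEq] at he
  · exact GridCell.vtx_ne_conn _ _ _ he.1.symm
  · exact GridCell.vtx_ne_conn _ _ _ he.2.symm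

variable (hw : WidthOK ψ) (hN : 0 < N ψ)
include hw hN

/-- **Every edge of `graphOf ψ` is drawn.** [folklore] -/
theorem draws_of_adj {a b : ℕ} (h : (graphOf ψ).Adj a b) :
    (∃ o ∈ objs ψ, ∃ q ∈ absEdges o.1, SymEq (oname ψ o q.1, oname ψ o q.2) a b) ∨
      ∃ i < V ψ, SymEq (retStart ψ i, retEnd ψ i) a b := by
  have hV : 0 < V ψ := V_pos_of_N_pos ψ hN
  rw [GridFormulaFP.graphOf_adj_iff] at h
  -- reduce to one orientation
  suffices key : ∀ a b, (a, b) ∈ GridFormulaFP.edgesOf ψ →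
      (∃ o ∈ objs ψ, ∃ q ∈ absEdges o.1, SymEq (oname ψ o q.1, oname ψ o q.2) a b) ∨
        ∃ i < V ψ, SymEq (retStart ψ i, retEnd ψ i) a b by
    rcases h with h | h
    · exact key a b h
    · rcases key b a h with ⟨o, ho, q, hq, hs⟩ | ⟨i, hi, hs⟩
      · exact Or.inl ⟨o, ho, q, hq, hs.comm⟩
      · exact Or.inr ⟨i, hi, hs.comm⟩
  intro a b h
  unfold GridFormulaFP.edgesOf at h
  rw [List.mem_append, List.mem_filter, List.mem_flatMap] at h
  rcases h with ⟨hch, hns⟩ | ⟨g, hg, hpe⟩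
  · -- a chain edge, not a slot
    simp only [decide_eq_true_eq] at hns
    obtain ⟨kc, hkc, h⟩ := (GridFormulaFP.mem_chainEdgesN_iff ψ).1 hch
    rcases h with h | h | ⟨hk1, h⟩
    · -- connector to entry corner: the cell object
      obtain ⟨i, jj, c, ht, hkck, hsome⟩ := exists_tile_of_lt_ncells hN hkc
      obtain ⟨⟨ty, U'⟩, hcell⟩ := Option.isSome_iff_exists.1 hsome
      have hc3 : c < 3 := by
        rw [absCell_bspecAt ht] at hcell; split_ifs at hcell <;> omega
      obtain ⟨κ, hκ, U, hcd, -⟩ := cellData_of_absCell (BSpec.mem_all _) hc3 hcell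
      have ho : ((κ, i, jj) : Obj) ∈ objs ψ := (mem_objs_iff ψ).2 ⟨ht, hκ⟩
      obtain ⟨hty, -⟩ := cell_type hN ho hcd
      refine Or.inl ⟨_, ho, (.cell 0 0 c 0, .cell 0 0 c (ty.pIdx.val + 1)), ?_, Or.inl ?_⟩
      · have hnone : chordData κ = none := by revert hcd; cases κ <;> simp [cellData, chordData]
        simp only [absEdges, hnone, hcd, List.mem_append, List.mem_singleton, or_true]
      · simp only [Prod.mk.injEq] at h
        obtain ⟨rfl, rfl⟩ := h
        simp only [oname, gname_cell00, hkck, ← hty]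
        exact ⟨rfl, by simp [GridCell.vtx]; ring⟩
    · -- a cell edge: the cell object, the edge not slotted
      obtain ⟨x, y, hxy, hab⟩ := GridFormulaFP.mem_cellEdgesN_iff.1 h
      simp only [Prod.mk.injEq] at hab
      obtain ⟨rfl, rfl⟩ := hab
      obtain ⟨i, jj, c, ht, hkck, hsome⟩ := exists_tile_of_lt_ncells hN hkc
      obtain ⟨⟨ty, U'⟩, hcell⟩ := Option.isSome_iff_exists.1 hsome
      have hc3 : c < 3 := by
        rw [absCell_bspecAt ht] at hcell; split_ifs at hcell <;> omega
      obtain ⟨κ, hκ, U, hcd, -⟩ := cellData_of_absCell (BSpec.mem_all _) hc3 hcell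
      have ho : ((κ, i, jj) : Obj) ∈ objs ψ := (mem_objs_iff ψ).2 ⟨ht, hκ⟩
      obtain ⟨hty, -⟩ := cell_type hN ho hcd
      rw [hkck] at hty
      subst hty
      have hU : (x, y) ∉ U := by
        intro hxU
        obtain ⟨g, hg, hS⟩ := (cell_slots hw hN ho hcd x y).1 (Or.inl hxU)
        rw [hkck] at hS
        rcases hS with hS | hS
        · exact hns.1 ((GridFormulaFP.mem_slotsOf_iff ψ).2 ⟨g, hg, hS⟩)
        · exact hns.2 ((GridFormulaFP.mem_slotsOf_iff ψ).2 ⟨g, hg, hS⟩)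
      refine Or.inl ⟨_, ho, (.cell 0 0 c (x.val + 1), .cell 0 0 c (y.val + 1)), ?_, Or.inl ?_⟩
      · have hnone : chordData κ = none := by revert hcd; cases κ <;> simp [cellData, chordData]
        simp only [absEdges, hnone, hcd, List.mem_append, List.mem_map, List.mem_filter]
        exact Or.inl ⟨(x, y), ⟨hxy, by simpa using hU⟩, rfl⟩
      · simp only [oname, gname_cell00, hkck]
        exact ⟨by simp [GridCell.vtx]; ring, by simp [GridCell.vtx]; ring⟩
    · -- exit corner to the next connector: a connector object or a return path
      simp only [Prod.mk.injEq] at h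
      obtain ⟨rfl, rfl⟩ := h
      rcases conn_edge_drawn hN hk1 with ⟨o, ho, d, hcd, hk, hty, hnext⟩ | ⟨i, hi, hs, he⟩
      · refine Or.inl ⟨o, ho, (.cell 0 0 d.1 (d.2.1.qIdx.val + 1), .cell 0 d.2.2.1 d.2.2.2 0), ?_, Or.inl ?_⟩
        · have h1 : chordData o.1 = none := by revert hcd; cases o.1 <;> simp [connData, chordData]
          have h2 : cellData o.1 = none := by revert hcd; cases o.1 <;> simp [connData, cellData]
          simp only [absEdges, h1, h2, hcd, List.mem_singleton]
        · have e1 : oname ψ o (Ref.cell 0 0 d.1 (d.2.1.qIdx.val + 1)) = vtx kc (cellTyAt ψ kc).qIdx := by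
            simp only [oname, gname]
            rw [show ((o.2.1 : ℤ) + 0) = o.2.1 by simp, show ((o.2.2 : ℤ) + 0) = o.2.2 by simp, hk, hty]
            simp [GridCell.vtx]; ring
          have e2 : oname ψ o (Ref.cell 0 d.2.2.1 d.2.2.2 0) = conn (kc + 1) := by
            simp only [oname, gname]
            rw [show ((o.2.1 : ℤ) + 0) = o.2.1 by simp, hnext]; simp [GridCell.conn]
          exact ⟨e1, e2⟩
      · exact Or.inr ⟨i, hi, Or.inl ⟨hs, he⟩⟩
  · -- a gadget edge: the chord object
    rw [List.mem_range] at hg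
    have hadj : ((family ψ).GX g).Adj a b := (GridFormulaFP.gadget_adj_iff_mem ψ).2 (Or.inl hpe)
    have hplace : ∃ spec, gad ψ g = some spec := by
      rw [family_GX] at hadj
      cases hP : place ψ g with
      | none => rw [hP] at hadj; exact absurd hadj (by simp)
      | some P =>
        unfold place at hP
        cases hs : gad ψ g with
        | none => rw [hs] at hP; simp at hP
        | some spec => exact ⟨spec, rfl⟩
    obtain ⟨spec, hs⟩ := hplace
    obtain ⟨i, jj, f, rs, ht, hgi, hrs, -⟩ := absGad_of_gad hw hN hg hs
    obtain ⟨κ, hκ, hcd⟩ := chordData_of_rs (BSpec.mem_all _) (f_lt_of_absGad hrs) hrs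
    have ho : ((κ, i, jj) : Obj) ∈ objs ψ := (mem_objs_iff ψ).2 ⟨ht, hκ⟩
    obtain ⟨-, hGX, -⟩ := chord_gadget hw ho hcd
    have hf : (rs.toChordData f).f = f := by cases rs <;> rfl
    rw [hf, hgi] at hGX
    obtain ⟨q, hq, hab⟩ := (hGX a b).1 hadj
    refine Or.inl ⟨_, ho, q, hq, ?_⟩
    rcases hab with ⟨h1, h2⟩ | ⟨h1, h2⟩
    · exact Or.inl ⟨h1.symm, h2.symm⟩
    · exact Or.inr ⟨h2.symm, h1.symm⟩

/-- **Every drawn edge is an edge of `graphOf ψ`.** [folklore] -/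
theorem adj_of_draws {a b : ℕ}
    (h : (∃ o ∈ objs ψ, ∃ q ∈ absEdges o.1, SymEq (oname ψ o q.1, oname ψ o q.2) a b) ∨
      ∃ i < V ψ, SymEq (retStart ψ i, retEnd ψ i) a b) :
    (graphOf ψ).Adj a b := by
  have hV : 0 < V ψ := V_pos_of_N_pos ψ hN
  rw [GridFormulaFP.graphOf_adj_iff]
  -- it suffices to put the named pair into `edgesOf`
  suffices key : ∀ p : ℕ × ℕ, ((∃ o ∈ objs ψ, ∃ q ∈ absEdges o.1, p = (oname ψ o q.1, oname ψ o q.2)) ∨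
      ∃ i < V ψ, p = (retStart ψ i, retEnd ψ i)) → p ∈ GridFormulaFP.edgesOf ψ ∨ p.swap ∈ GridFormulaFP.edgesOf ψ by
    rcases h with ⟨o, ho, q, hq, hs⟩ | ⟨i, hi, hs⟩
    · rcases key _ (Or.inl ⟨o, ho, q, hq, rfl⟩) with h | h <;> rcases hs with ⟨rfl, rfl⟩ | ⟨rfl, rfl⟩
      · exact Or.inl h
      · exact Or.inr h
      · exact Or.inr h
      · exact Or.inl h
    · rcases key _ (Or.inr ⟨i, hi, rfl⟩) with h | h <;> rcases hs with ⟨rfl, rfl⟩ | ⟨rfl, rfl⟩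
      · exact Or.inl h
      · exact Or.inr h
      · exact Or.inr h
      · exact Or.inl h
  have memE : ∀ p : ℕ × ℕ, (p ∈ GridFormulaFP.chainEdgesN ψ ∧ p ∉ GridFormulaFP.slotsOf ψ ∧ p.swap ∉ GridFormulaFP.slotsOf ψ) ∨
      (∃ g < ngadgets ψ, p ∈ GridFormulaFP.placeEdges ψ g) → p ∈ GridFormulaFP.edgesOf ψ := by
    intro p hp
    unfold GridFormulaFP.edgesOf
    rw [List.mem_append, List.mem_filter, List.mem_flatMap]
    rcases hp with ⟨h1, h2, h3⟩ | ⟨g, hg, h⟩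
    · exact Or.inl ⟨h1, by simp [h2, h3]⟩
    · exact Or.inr ⟨g, List.mem_range.2 hg, h⟩
  rintro p (⟨o, ho, q, hq, rfl⟩ | ⟨i, hi, rfl⟩)
  · obtain ⟨κ, i, jj⟩ := o
    obtain ⟨ht, hκ⟩ := (mem_objs_iff ψ).1 ho
    simp only at ht hκ hq ⊢
    rcases kind_cases κ with ⟨cd, hcd⟩ | ⟨⟨ty, c, U⟩, hnone, hcd⟩ | ⟨⟨c, ty, dj, c'⟩, h1, h2, hcd⟩
    · -- a chord: a gadget edge
      obtain ⟨hlt, hGX, -⟩ := chord_gadget hw ho hcd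
      have hadj : ((family ψ).GX (gadAt ψ i jj cd.f)).Adj (oname ψ (κ, i, jj) q.1) (oname ψ (κ, i, jj) q.2) :=
        (hGX _ _).2 ⟨q, hq, Or.inl ⟨rfl, rfl⟩⟩
      rcases (GridFormulaFP.gadget_adj_iff_mem ψ).1 hadj with h | h
      · exact Or.inl (memE _ (Or.inr ⟨_, hlt, h⟩))
      · exact Or.inr (memE _ (Or.inr ⟨_, hlt, h⟩))
    · -- a cell: a cell edge not slotted, or the connector edge
      obtain ⟨hty, hklt⟩ := cell_type hN ho hcd
      simp only [absEdges, hnone, hcd, List.mem_append, List.mem_map, List.mem_filter, List.mem_singleton] at hq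
      rcases hq with ⟨⟨x, y⟩, ⟨hxy, hU⟩, rfl⟩ | rfl
      · simp only [Bool.not_eq_true', decide_eq_false_iff_not] at hU
        left
        apply memE
        left
        have hedge : (oname ψ (κ, i, jj) (Ref.cell 0 0 c (x.val + 1)), oname ψ (κ, i, jj) (Ref.cell 0 0 c (y.val + 1))) =
            (vtx (cellAt ψ i jj c) x, vtx (cellAt ψ i jj c) y) := by
          simp only [oname, gname_cell00, GridCell.vtx, Prod.mk.injEq]; constructor <;> ring
        rw [hedge]
        refine ⟨(GridFormulaFP.mem_chainEdgesN_iff ψ).2 ⟨_, hklt, Or.inr (Or.inl ?_)⟩, ?_, ?_⟩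
        · rw [hty]; exact GridFormulaFP.mem_cellEdgesN_iff.2 ⟨x, y, hxy, rfl⟩
        · intro hs
          obtain ⟨g, hg, hS⟩ := (GridFormulaFP.mem_slotsOf_iff ψ).1 hs
          have := (cell_slots hw hN ho hcd x y).2 ⟨g, hg, Or.inl hS⟩
          rcases this with h | h
          · exact hU h
          · -- an increasing cell edge whose swap is slotted: impossible
            have hsub := cellData_U_ok κ
            rw [hcd] at hsub
            simp only [List.all_eq_true, List.contains_iff_mem] at hsub
            have h1 := hsub _ h
            have hlt := edgeList_lt ty
            simp only [List.all_eq_true, decide_eq_true_eq] at hlt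
            have := hlt _ h1; have := hlt _ hxy
            simp only at *; omega
        · intro hs
          obtain ⟨g, hg, hS⟩ := (GridFormulaFP.mem_slotsOf_iff ψ).1 hs
          have := (cell_slots hw hN ho hcd x y).2 ⟨g, hg, Or.inr hS⟩
          rcases this with h | h
          · exact hU h
          · have hsub := cellData_U_ok κ
            rw [hcd] at hsub
            simp only [List.all_eq_true, List.contains_iff_mem] at hsub
            have h1 := hsub _ h
            have hlt := edgeList_lt ty
            simp only [List.all_eq_true, decide_eq_true_eq] at hlt
            have := hlt _ h1; have := hlt _ hxy
            simp only at *; omega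
      · left
        apply memE
        left
        have hedge : (oname ψ (κ, i, jj) (Ref.cell 0 0 c 0), oname ψ (κ, i, jj) (Ref.cell 0 0 c (ty.pIdx.val + 1))) =
            (conn (cellAt ψ i jj c), vtx (cellAt ψ i jj c) (cellTyAt ψ (cellAt ψ i jj c)).pIdx) := by
          simp only [oname, gname_cell00, GridCell.vtx, GridCell.conn, hty, Prod.mk.injEq]; constructor <;> ring
        rw [hedge]
        exact ⟨(GridFormulaFP.mem_chainEdgesN_iff ψ).2 ⟨_, hklt, Or.inl rfl⟩, (not_mem_slotsOf_conn _ _).1,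
          (not_mem_slotsOf_conn _ _).2⟩
    · -- a connector
      have hd := absConns_of_connData (BSpec.mem_all _) hκ hcd
      obtain ⟨hty, hnext, hklt, -⟩ := absConns_bspecAt hN ht hd
      simp only at hty hnext hklt
      simp only [absEdges, h1, h2, hcd, List.mem_singleton] at hq
      subst hq
      left
      apply memE
      left
      have hedge : (oname ψ (κ, i, jj) (Ref.cell 0 0 c (ty.qIdx.val + 1)), oname ψ (κ, i, jj) (Ref.cell 0 dj c' 0)) =
          (vtx (cellAt ψ i jj c) (cellTyAt ψ (cellAt ψ i jj c)).qIdx, conn (cellAt ψ i jj c + 1)) := by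
        simp only [oname, gname, ← hty, GridCell.vtx, GridCell.conn, Prod.mk.injEq]
        refine ⟨by ring_nf, ?_⟩
        rw [show ((i : ℤ) + 0) = i by simp, hnext]; ring
      rw [hedge]
      exact ⟨(GridFormulaFP.mem_chainEdgesN_iff ψ).2 ⟨_, by omega, Or.inr (Or.inr ⟨hklt, rfl⟩)⟩,
        (not_mem_slotsOf_conn _ _).2, (not_mem_slotsOf_conn _ _).1⟩
  · -- a return path: the exit corner of the last cell of row `i` to the next connector
    left
    apply memE
    left
    have hk : tileCell ψ i (N ψ - 1) 2 + 1 < ncells ψ := by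
      have h1 : (i + 1) * N ψ ≤ V ψ * N ψ := Nat.mul_le_mul_right _ hi
      have h2 : (i + 1) * N ψ = i * N ψ + N ψ := Nat.succ_mul _ _
      unfold tileCell ncells
      omega
    have hq : (cellTyAt ψ (tileCell ψ i (N ψ - 1) 2)).qIdx = 3 := by
      have hty := cellTyAt_tileCell_cases ψ hi (show N ψ - 1 < N ψ by omega)
      by_cases hcr : tileTy ψ i (N ψ - 1) = .cross
      · rw [(hty.1 hcr).2.2]; rfl
      · rw [hty.2 hcr 2 (by omega)]; rfl
    have hedge : (retStart ψ i, retEnd ψ i) =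
        (vtx (tileCell ψ i (N ψ - 1) 2) (cellTyAt ψ (tileCell ψ i (N ψ - 1) 2)).qIdx, conn (tileCell ψ i (N ψ - 1) 2 + 1)) := by
      rw [hq]; simp [retStart, retEnd, GridCell.vtx, GridCell.conn]
    rw [hedge]
    exact ⟨(GridFormulaFP.mem_chainEdgesN_iff ψ).2 ⟨_, by omega, Or.inr (Or.inr ⟨hk, rfl⟩)⟩,
      (not_mem_slotsOf_conn _ _).2, (not_mem_slotsOf_conn _ _).1⟩

/-- **The drawing draws `graphOf ψ`**: two names are adjacent in `graphOf ψ` iff some drawn edge has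
them as its ends. [folklore] -/
theorem adj_iff_draws {a b : ℕ} :
    (graphOf ψ).Adj a b ↔ ∃ d ∈ (drawing ψ).edges, (d.1 = a ∧ d.2.1 = b) ∨ (d.1 = b ∧ d.2.1 = a) := by
  rw [draws_iff]
  exact ⟨draws_of_adj hw hN, adj_of_draws hw hN⟩

end draws

/-! ## The drawn vertices are the vertices of `graphOf ψ` -/

section dverts

/-- Own references of a kind are its abstract vertices (from `absVerts_ok`). [folklore] -/
theorem mem_absVerts_iff {κ : Kind} {r : Ref} : r ∈ absVerts κ ↔ ∃ a ∈ Kind.verts κ, a.1 = r := by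
  have hok := absVerts_ok κ
  simp only [listSetEqB, Bool.and_eq_true, List.all_eq_true, List.contains_iff_mem, List.mem_map] at hok
  obtain ⟨h1, h2⟩ := hok
  constructor
  · intro h; exact h2 _ h
  · rintro ⟨a, ha, rfl⟩; exact h1 _ ⟨a, ha, rfl⟩

variable (hw : WidthOK ψ) (hN : 0 < N ψ)
include hw hN

/-- **A drawn vertex is a vertex of `graphOf ψ`.** [folklore] -/
theorem mem_vertsOf_of_mem_dverts {v : ℕ} (hv : v ∈ (drawing ψ).verts) : v ∈ vertsOf ψ := by
  rw [GridFormulaFP.mem_vertsOf_iff, GridFormulaFP.vertsListOf, List.mem_append, List.mem_flatMap]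
  obtain ⟨o, ho, a, ha, rfl⟩ := mem_dverts_iff.1 hv
  obtain ⟨κ, i, jj⟩ := o
  obtain ⟨ht, hκ⟩ := (mem_objs_iff ψ).1 ho
  simp only at ht hκ ha ⊢
  have hr : a.1 ∈ absVerts κ := mem_absVerts_iff.2 ⟨a, ha, rfl⟩
  rcases kind_cases κ with ⟨cd, hcd⟩ | ⟨⟨ty, c, U⟩, hnone, hcd⟩ | ⟨⟨c, ty, dj, c'⟩, h1, h2, hcd⟩
  · -- a chord: a gadget vertex
    obtain ⟨hlt, -, hVX⟩ := chord_gadget hw ho hcd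
    right
    exact ⟨_, List.mem_range.2 hlt, (GridFormulaFP.mem_placeVerts_iff ψ).2 ((hVX _).2 ⟨a.1, hr, rfl⟩)⟩
  · -- a cell: a chain vertex
    obtain ⟨hty, hklt⟩ := cell_type hN ho hcd
    left
    simp only [absVerts, hnone, hcd, List.mem_cons, List.mem_map] at hr
    unfold GridFormulaFP.chainVertsN
    rw [List.mem_flatMap]
    refine ⟨cellAt ψ i jj c, List.mem_range.2 hklt, ?_⟩
    rcases hr with hr | ⟨x, hx, hr⟩
    · rw [hr]; simp [oname, gname_cell00, GridCell.conn]
    · right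
      rw [← hr, hty]
      exact List.mem_map.2 ⟨x, hx, by simp [oname, gname_cell00, GridCell.vtx]; ring⟩
  · -- a connector owns nothing
    simp [absVerts, h1, h2] at hr

/-- **A vertex of `graphOf ψ` is drawn.** [folklore] -/
theorem mem_dverts_of_mem_vertsOf {v : ℕ} (hv : v ∈ vertsOf ψ) : v ∈ (drawing ψ).verts := by
  have hV : 0 < V ψ := V_pos_of_N_pos ψ hN
  rw [GridFormulaFP.mem_vertsOf_iff, GridFormulaFP.vertsListOf, List.mem_append, List.mem_flatMap] at hv
  rcases hv with hv | ⟨g, hg, hv⟩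
  · -- a chain vertex: the cell object of its cell
    unfold GridFormulaFP.chainVertsN at hv
    rw [List.mem_flatMap] at hv
    obtain ⟨kc, hkc, hv⟩ := hv
    rw [List.mem_range] at hkc
    obtain ⟨i, jj, c, ht, hkck, hsome⟩ := exists_tile_of_lt_ncells hN hkc
    obtain ⟨⟨ty, U'⟩, hcell⟩ := Option.isSome_iff_exists.1 hsome
    have hc3 : c < 3 := by
      rw [absCell_bspecAt ht] at hcell; split_ifs at hcell <;> omega
    obtain ⟨κ, hκ, U, hcd, -⟩ := cellData_of_absCell (BSpec.mem_all _) hc3 hcell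
    have ho : ((κ, i, jj) : Obj) ∈ objs ψ := (mem_objs_iff ψ).2 ⟨ht, hκ⟩
    obtain ⟨hty, -⟩ := cell_type hN ho hcd
    rw [hkck] at hty
    have hnone : chordData κ = none := by revert hcd; cases κ <;> simp [cellData, chordData]
    have habs : ∀ r, r ∈ absVerts κ ↔ r = Ref.cell 0 0 c 0 ∨ ∃ x ∈ ty.vertList, r = Ref.cell 0 0 c (x.val + 1) := by
      intro r; simp only [absVerts, hnone, hcd, List.mem_cons, List.mem_map]
      constructor
      · rintro (h | ⟨x, hx, h⟩); exacts [Or.inl h, Or.inr ⟨x, hx, h.symm⟩]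
      · rintro (h | ⟨x, hx, h⟩); exacts [Or.inl h, Or.inr ⟨x, hx, h.symm⟩]
    rw [List.mem_cons, List.mem_map] at hv
    rcases hv with rfl | ⟨x, hx, rfl⟩
    · obtain ⟨a, ha, har⟩ := mem_absVerts_iff.1 ((habs _).2 (Or.inl rfl))
      refine mem_dverts_iff.2 ⟨_, ho, a, ha, ?_⟩
      rw [har]; simp [oname, gname_cell00, GridCell.conn, hkck]
    · rw [hty] at hx
      obtain ⟨a, ha, har⟩ := mem_absVerts_iff.1 ((habs _).2 (Or.inr ⟨x, hx, rfl⟩))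
      refine mem_dverts_iff.2 ⟨_, ho, a, ha, ?_⟩
      rw [har]; simp [oname, gname_cell00, GridCell.vtx, hkck]; ring
  · -- a gadget vertex: the chord object of its gadget
    rw [List.mem_range] at hg
    have hVX := (GridFormulaFP.mem_placeVerts_iff ψ).1 hv
    have hplace : ∃ spec, gad ψ g = some spec := by
      rw [family_VX] at hVX
      cases hP : place ψ g with
      | none => rw [hP] at hVX; simp at hVX
      | some P =>
        unfold place at hP
        cases hs : gad ψ g with
        | none => rw [hs] at hP; simp at hP
        | some spec => exact ⟨spec, rfl⟩
    obtain ⟨spec, hs⟩ := hplace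
    obtain ⟨i, jj, f, rs, ht, hgi, hrs, -⟩ := absGad_of_gad hw hN hg hs
    obtain ⟨κ, hκ, hcd⟩ := chordData_of_rs (BSpec.mem_all _) (f_lt_of_absGad hrs) hrs
    have ho : ((κ, i, jj) : Obj) ∈ objs ψ := (mem_objs_iff ψ).2 ⟨ht, hκ⟩
    obtain ⟨-, -, hVXiff⟩ := chord_gadget hw ho hcd
    have hf : (rs.toChordData f).f = f := by cases rs <;> rfl
    rw [hf, hgi] at hVXiff
    obtain ⟨r, hr, rfl⟩ := (hVXiff v).1 hVX
    obtain ⟨a, ha, har⟩ := mem_absVerts_iff.1 hr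
    exact mem_dverts_iff.2 ⟨_, ho, a, ha, by rw [har]⟩

/-- **The drawn vertices are the vertices of `graphOf ψ`.** [folklore] -/
theorem dverts_toFinset : (drawing ψ).verts.toFinset = vertsOf ψ := by
  ext v
  rw [List.mem_toFinset]
  exact ⟨mem_vertsOf_of_mem_dverts hw hN, mem_dverts_of_mem_vertsOf hw hN⟩

/-- The start vertex `conn 0 = 0` is drawn. [folklore] -/
theorem zero_mem_dverts : 0 ∈ (drawing ψ).verts := by
  apply mem_dverts_of_mem_vertsOf hw hN
  rw [GridFormulaFP.mem_vertsOf_iff, GridFormulaFP.vertsListOf, List.mem_append]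
  left
  unfold GridFormulaFP.chainVertsN
  rw [List.mem_flatMap]
  exact ⟨0, List.mem_range.2 (by unfold ncells; omega), by simp [GridCell.conn]⟩

/-- The end vertex `lastQ` is drawn. [folklore] -/
theorem lastQ_mem_dverts : GridCell.lastQ (cellsOf ψ) ∈ (drawing ψ).verts := by
  apply mem_dverts_of_mem_vertsOf hw hN
  rw [GridFormulaFP.mem_vertsOf_iff, GridFormulaFP.vertsListOf, List.mem_append]
  left
  rw [GridFormulaFP.mem_chainVertsN_iff]
  unfold GridCell.lastQ
  rw [GridCell.vtx_mem_chainVerts_iff]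
  refine ⟨by rw [length_cellsOf]; unfold ncells; omega, ?_⟩
  have hq : ∀ ty : GridCell.CellTy, ty.qIdx ∈ ty.vertList := by intro ty; cases ty <;> decide
  exact hq _

end dverts

end Literature.Barriers.CriticalPhenomena.GridSAW.FormulaDrawing
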